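import Literature.Barriers.AtomisticToContinuum.FeynmanCyclesVersusCondensationRecursion
import Mathlib.Analysis.SpecialFunctions.Gaussian.PoissonSummation
import Mathlib.Analysis.SpecialFunctions.Pow.Real
import Mathlib.Analysis.SpecialFunctions.Log.Basic
import Mathlib.Analysis.SpecialFunctions.Sqrt
import Mathlib.Analysis.Real.Pi.Bounds
import Mathlib.Analysis.PSeries
import Mathlib.Analysis.Normed.Group.Tannery
import Mathlib.Analysis.SpecificLimits.Basic
import Mathlib.Topology.Algebra.InfiniteSum.NatInt
import Literature.Barriers.AtomisticToContinuum.FeynmanCyclesVersusCondensation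
import Mathlib.Tactic

/-!
# Proof of the barrier fact `FeynmanCyclesVersusCondensation` (perfect Bose gas: cycle percolation = condensate fraction)

This file discharges the named fact
`Literature.Barriers.AtomisticToContinuum.FeynmanCyclesVersusCondensation` of
`Literature/Barriers/AtomisticToContinuum/FeynmanCyclesVersusCondensation.lean`, the conjunction
of `Suto2002_cyclePercolation` (Sütő 2002, (29)–(30) summed: the limits
`P_ρ(ξ₁=j) = lim_N P_{Λ_{L_N},N}(ξ₁=j)` exist and `∑_j P_ρ(ξ₁=j) = min(1, ρ_c/ρ)`) and
`Ueltschi2006_zeroModeOccupation` (Ueltschi 2006, Thm. 4: `⟨n₀⟩_{Λ,N}/L³ → max(0, ρ-ρ_c)`),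
both for `d = 3` along `L_N = (N/ρ)^{1/3}` (`FeynmanCyclesVersusCondensation_holds`, at the end).

Neither source prints a self-contained proof of these canonical-ensemble limits: [Suto2002, §2.2]
argues via the strong equivalence of ensembles and the asymptotic degeneracy of the
Kac distribution (Buffet–Pulé), [Ueltschi2006, App. B] bounds `⟨n₀⟩` above through the
large-deviation identity `V⁻¹ log Prob(n₀ ≥ Va) → f(β,ρ) - f(β,ρ-a)` for the canonical free
energy.  The proof given here is elementary and stays inside the canonical ensemble:

* **Structure of `Q_{Λ,N}`** (`canonicalZ_rec`, `canonicalZ_monotone`, `canonicalZ_logConcave`):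
  Sütő's cycle-index recursion `N Q_N = ∑_{j=1}^N tr e^{-jβT} Q_{N-j}` [Suto2002, §1 (4)–(5),
  §2.1 (7), (10)] (support file `…Recursion`), monotonicity `Q_{N-1} ≤ Q_N` [Suto2002, §2.1 after
  (10)] by peeling off the zero mode, and log-concavity `Q_N Q_{N+2} ≤ Q_{N+1}²` (the `Q_N` are
  complete homogeneous symmetric functions of the Boltzmann weights; finite truncations are
  convolutions of geometric sequences), so that the canonical activity `Q_{N-1}/Q_N` is
  nondecreasing in `N` and `≤ 1`.
* **Key lemma** (`tendsto_activity`): along any `L_k → ∞`, `M_k/L_k³ → ρ' > 0`, the activity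
  `Q_{Λ,M_k}/Q_{Λ,M_k+1}` converges to the saturated activity `ζ` (`g_{3/2}(ζ) = ρ'λ_B³` for
  `ρ' < ρ_c`, `ζ = 1` otherwise) [Suto2002, §2.2 (28)–(30)]: if the activity were `≤ x < ζ`, the
  divided recursion `M+1 = ∑_j tr e^{-jβT} Q_{M+1-j}/Q_{M+1} ≤ ∑_j tr e^{-jβT} x^j ≈ L³g(x)/λ³`
  contradicts `g(x)/λ³ < ρ'`; if it were `≥ x > ζ` (`ζ < 1`), truncating the identity at level
  `M+J` to `J` terms gives `M+J ≳ L³ g_J(x)/λ³ > L³ρ'`.  The theta-function input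
  (`tr e^{-jβT}/L³ → 1/(λ_B√j)³`, the Riemann-sum limit, Sütő's bounds (8)) is Part I below.
* **Sütő** (`tendsto_cycleLengthProb`, `suto2002_cyclePercolation_holds`):
  `P_{Λ,N}(ξ₁=j) = (tr e^{-jβT}/N) ∏_{i<j} Q_{N-j+i}/Q_{N-j+i+1} → ζ^j/(ρλ_B³ j^{3/2})`, summing to
  `g_{3/2}(ζ)/(ρλ_B³) = min(1, ρ_c/ρ)`.
* **Ueltschi** (`ueltschi2006_zeroModeOccupation_holds`): the lower bound is Ueltschi's own sum
  rule `N - ⟨n₀⟩ = ∑_j (tr e^{-jβT} - 1) Q_{N-j}/Q_N ≤ ∑_{j≤N} (tr e^{-jβT} - 1) ≲ L³ρ_c`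
  [Ueltschi2006, App. B]; the upper bound cuts `⟨n₀⟩ = ∑_{i=1}^N Q_{N-i}/Q_N` at
  `i₀ = ⌈(ρ₀+δ)L³⌉`: the first terms are `≤ 1`, the tail is a geometric series in the activity at
  density `min(ρ,ρ_c) - δ`, which tends to some `ζ' < 1` by the key lemma.

## Part I — Theta-function bounds for `tr e^{tΔ}` on the torus and the Bose function `g_{3/2}`

Units `ħ = 2m = 1`, `λ_B = √(4πβ)` (`thermalWavelength`), one-particle heat trace
`torusHeatTrace L t = θ(L,t)³`, `θ(L,t) = ∑_{n∈ℤ} e^{-t(2πn/L)²}`.  All statements of this file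
are theorems about the objects of the catalogue file; no definitions are introduced (the Bose
function is written out as `∑' j, x^(j+1)/√(j+1)³ = g_{3/2}(x) = ∑_{j≥1} x^j/j^{3/2}`, the
recursion as the explicit hypotheses of `…Recursion`).

* Sütő's bounds [Suto2002, §2.1 (8)–(9)] `(L/(λ_B√j))³ ≤ tr e^{-jβT_{Λ,1}} ≤ (L/(λ_B√j)+1)³`
  (`torusHeatTrace_cycle_bounds`), here from Poisson summation (`torusTheta_poisson`, Mathlib's
  `Real.tsum_exp_neg_mul_int_sq`) and the elementary `∑_{n∈ℤ} e^{-cn²} ≤ 1 + 2/c`;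
  also `tr e^{tΔ} ≥ 1`.
* Consequences: `tr e^{-jβT}/L³ → 1/(λ_B√j)³` (`tendsto_torusHeatTrace_div_cube`); the Riemann-sum
  limit `L^{-3}∑_{j≤M} tr e^{-jβT} x^j → g_{3/2}(x)/λ_B³` for `0 ≤ x < 1`
  (`tendsto_sum_torusHeatTrace_mul_pow`, Tannery); and the excited-mode bound
  `L^{-3}∑_{j≤N}(tr e^{-jβT} - 1) ≤ g_{3/2}(1)/λ_B³ + o(1)` when `N = O(L³)`
  (`eventually_sum_torusHeatTrace_sub_one_le`, via `(a+1)³-1 = a³+3a²+3a`, `∑1/j ≤ 1+log N`,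
  `∑ 1/√j ≤ 2√N`).
* The Bose function on `[0,1]`: summable, continuous, strictly increasing, `g(0) = 0`,
  `g(1) = ∑ j^{-3/2}` (`boseFun_one`, the numerator of `criticalDensity`), and the saturated
  activity `ζ ∈ (0,1]` with `g(ζ) = min(y, g(1))` (`exists_saturatedActivity`), i.e. the solution
  of `g_{3/2}(z) = ρλ_B³` for `ρ < ρ_c` and `z = 1` for `ρ ≥ ρ_c` [Suto2002, §2.2 (28)–(30)].

## References

* [Suto2002] A. Sütő, *Percolation transition in the Bose gas: II*, J. Phys. A 35 (2002)
  6995–7002, arXiv:cond-mat/0204430: §1 (4)–(5), Theorem; §2.1 (7)–(12); §2.2 (28)–(30) and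
  Remarks 1–2.
* [Ueltschi2006] D. Ueltschi, *Feynman cycles in the Bose gas*, J. Math. Phys. 47 (2006) 123303,
  arXiv:math-ph/0605002: App. B, Thm. 4 and its proof.
-/

noncomputable section

open Filter Finset Real
open scoped BigOperators Topology

namespace Literature.Barriers.AtomisticToContinuum.BoseGas.IdealGas

/-! ### One-dimensional Gaussian lattice sums -/

/-- `∑_{n ∈ ℤ} e^{-c n²}` converges for `c > 0`. [folklore] -/
theorem summable_exp_neg_mul_intSq {c : ℝ} (hc : 0 < c) :
    Summable fun n : ℤ => Real.exp (-(c * (n : ℝ) ^ 2)) := by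
  have h := summable_torusHeat (L := 2 * Real.pi) (t := c) (by positivity) hc
  refine h.congr fun n => ?_
  congr 2
  field_simp

/-- `∑_{n ≥ 1} e^{-c n²} ≤ 1/c` (compare with the geometric series and `e^c - 1 ≥ c`).
[folklore] -/
theorem tsum_exp_neg_mul_succSq_le {c : ℝ} (hc : 0 < c) :
    Summable (fun n : ℕ => Real.exp (-(c * ((n : ℝ) + 1) ^ 2))) ∧
      ∑' n : ℕ, Real.exp (-(c * ((n : ℝ) + 1) ^ 2)) ≤ 1 / c := by
  set r := Real.exp (-c) with hr
  have hr0 : 0 ≤ r := (Real.exp_pos _).le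
  have hr1 : r < 1 := Real.exp_lt_one_iff.mpr (by linarith)
  have hgeom : HasSum (fun n : ℕ => r ^ (n + 1)) (r / (1 - r)) := by
    have := (hasSum_geometric_of_lt_one hr0 hr1).mul_left r
    simpa [pow_succ', div_eq_mul_inv] using this
  have hle : ∀ n : ℕ, Real.exp (-(c * ((n : ℝ) + 1) ^ 2)) ≤ r ^ (n + 1) := by
    intro n
    rw [hr, ← Real.exp_nat_mul, Real.exp_le_exp]
    have h1 : (1 : ℝ) ≤ (n : ℝ) + 1 := by
      have : (0 : ℝ) ≤ n := n.cast_nonneg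
      linarith
    have h2 : (n : ℝ) + 1 ≤ ((n : ℝ) + 1) ^ 2 := by nlinarith
    have h3 := mul_le_mul_of_nonneg_left h2 hc.le
    push_cast
    linarith
  have hpos : ∀ n : ℕ, 0 ≤ Real.exp (-(c * ((n : ℝ) + 1) ^ 2)) := fun n => (Real.exp_pos _).le
  have hsum : Summable fun n : ℕ => Real.exp (-(c * ((n : ℝ) + 1) ^ 2)) :=
    Summable.of_nonneg_of_le hpos hle hgeom.summable
  refine ⟨hsum, ?_⟩
  calc ∑' n : ℕ, Real.exp (-(c * ((n : ℝ) + 1) ^ 2)) ≤ ∑' n : ℕ, r ^ (n + 1) :=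
        hsum.tsum_le_tsum hle hgeom.summable
    _ = r / (1 - r) := hgeom.tsum_eq
    _ ≤ 1 / c := by
        rw [div_le_div_iff₀ (by linarith) hc]
        -- `r c ≤ 1 - r`, i.e. `e^{-c} (1 + c) ≤ 1`
        have h1 : 1 + c ≤ Real.exp c := by linarith [Real.add_one_le_exp c]
        have h2 : Real.exp (-c) * Real.exp c = 1 := by rw [← Real.exp_add]; simp
        nlinarith [Real.exp_pos (-c)]

/-- `∑_{n ∈ ℤ} e^{-c n²} ≤ 1 + 2/c` for `c > 0`. [folklore] -/
theorem tsum_exp_neg_mul_intSq_le {c : ℝ} (hc : 0 < c) :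
    ∑' n : ℤ, Real.exp (-(c * (n : ℝ) ^ 2)) ≤ 1 + 2 / c := by
  obtain ⟨hs, hle⟩ := tsum_exp_neg_mul_succSq_le hc
  set f : ℤ → ℝ := fun n => Real.exp (-(c * (n : ℝ) ^ 2)) with hf
  have hnat : Summable fun n : ℕ => f n :=
    (summable_exp_neg_mul_intSq hc).comp_injective Nat.cast_injective
  have hshift : ∀ n : ℕ, f ((n + 1 : ℕ) : ℤ) = Real.exp (-(c * ((n : ℝ) + 1) ^ 2)) := by
    intro n; simp only [hf]; push_cast; ring_nf
  have hneg' : ∀ n : ℕ, f (-((n : ℤ) + 1)) = Real.exp (-(c * ((n : ℝ) + 1) ^ 2)) := by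
    intro n; simp only [hf]; push_cast; ring_nf
  have hneg : Summable fun n : ℕ => f (-((n : ℤ) + 1)) := by
    simp only [hneg']; exact hs
  rw [tsum_of_nat_of_neg_add_one hnat hneg, hnat.tsum_eq_zero_add]
  simp only [hneg', hshift]
  have h0 : f ((0 : ℕ) : ℤ) = 1 := by simp [hf]
  rw [h0]
  have : (1 : ℝ) + 2 / c = 1 + 1 / c + 1 / c := by ring
  rw [this]
  exact add_le_add (add_le_add le_rfl hle) hle

/-- `1 ≤ ∑_{n ∈ ℤ} e^{-c n²}` (the `n = 0` term). [folklore] -/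
theorem one_le_tsum_exp_neg_mul_intSq {c : ℝ} (hc : 0 < c) :
    1 ≤ ∑' n : ℤ, Real.exp (-(c * (n : ℝ) ^ 2)) := by
  have := (summable_exp_neg_mul_intSq hc).le_tsum 0 (fun j _ => (Real.exp_pos _).le)
  simpa using this

/-! ### The torus theta function `θ(L,t) = ∑_{n∈ℤ} exp(-t(2πn/L)²)` -/

/-- **Poisson summation** for the heat trace on the circle:
`∑_n e^{-t(2πn/L)²} = (L/√(4πt)) ∑_m e^{-π (L/√(4πt))² m²}`. [folklore] -/
theorem torusTheta_poisson {L t : ℝ} (hL : 0 < L) (ht : 0 < t) :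
    ∑' n : ℤ, Real.exp (-(t * (2 * Real.pi * n / L) ^ 2)) =
      L / Real.sqrt (4 * Real.pi * t) *
        ∑' n : ℤ, Real.exp (-(Real.pi * (L / Real.sqrt (4 * Real.pi * t)) ^ 2 * (n : ℝ) ^ 2)) := by
  have hπ := Real.pi_pos
  set A : ℝ := 4 * Real.pi * t / L ^ 2 with hA
  have hApos : 0 < A := by positivity
  have h4 : 0 < 4 * Real.pi * t := by positivity
  have hsq : Real.sqrt (4 * Real.pi * t) ^ 2 = 4 * Real.pi * t := Real.sq_sqrt h4.le
  have hs0 : 0 < Real.sqrt (4 * Real.pi * t) := Real.sqrt_pos.mpr h4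
  have hlhs : (fun n : ℤ => Real.exp (-(t * (2 * Real.pi * n / L) ^ 2))) =
      fun n : ℤ => Real.exp (-Real.pi * A * (n : ℝ) ^ 2) := by
    funext n; congr 1; rw [hA]; field_simp; ring
  have hA' : 1 / A ^ (1 / 2 : ℝ) = L / Real.sqrt (4 * Real.pi * t) := by
    rw [← Real.sqrt_eq_rpow, hA]
    have : 4 * Real.pi * t / L ^ 2 = (Real.sqrt (4 * Real.pi * t) / L) ^ 2 := by
      rw [div_pow, hsq]
    rw [this, Real.sqrt_sq (by positivity)]
    field_simp
  have hA'' : Real.pi / A = Real.pi * (L / Real.sqrt (4 * Real.pi * t)) ^ 2 := by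
    rw [hA, div_pow, hsq]
    field_simp
  rw [hlhs, Real.tsum_exp_neg_mul_int_sq hApos, hA']
  congr 1
  refine tsum_congr fun n => ?_
  congr 1
  rw [← hA'']
  ring

/-- `θ(L,t) ≥ 1`. [folklore] -/
theorem one_le_torusTheta {L t : ℝ} (hL : L ≠ 0) (ht : 0 < t) :
    1 ≤ ∑' n : ℤ, Real.exp (-(t * (2 * Real.pi * n / L) ^ 2)) := by
  have := (summable_torusHeat hL ht).le_tsum 0 (fun j _ => (Real.exp_pos _).le)
  simpa using this

/-- `θ(L,t) ≥ L/√(4πt)` (the `m = 0` term on the Poisson side).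
[cite: Suto2002, §2.1 (8)–(9)] -/
theorem div_sqrt_le_torusTheta {L t : ℝ} (hL : 0 < L) (ht : 0 < t) :
    L / Real.sqrt (4 * Real.pi * t) ≤ ∑' n : ℤ, Real.exp (-(t * (2 * Real.pi * n / L) ^ 2)) := by
  rw [torusTheta_poisson hL ht]
  have ha : 0 < L / Real.sqrt (4 * Real.pi * t) := by positivity
  have hc : 0 < Real.pi * (L / Real.sqrt (4 * Real.pi * t)) ^ 2 := by positivity
  have := one_le_tsum_exp_neg_mul_intSq hc
  nlinarith

/-- **Sütő's upper bound** `θ(L,t) ≤ L/√(4πt) + 1` (his (8): `tr e^{-jβT} < (L/(λ_B√j) + 1)^d`).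
Proof: with `a = L/√(4πt)`, for `a ≤ π/2` bound the direct series by `1 + 2a²/π ≤ 1 + a`, for
`a ≥ 2/π` bound the Poisson side by `a (1 + 2/(πa²)) ≤ a + 1`. [cite: Suto2002, §2.1 (8)–(9)] -/
theorem torusTheta_le {L t : ℝ} (hL : 0 < L) (ht : 0 < t) :
    ∑' n : ℤ, Real.exp (-(t * (2 * Real.pi * n / L) ^ 2)) ≤ L / Real.sqrt (4 * Real.pi * t) + 1 := by
  have hπ := Real.pi_pos
  have hπ3 := Real.pi_gt_three
  set a : ℝ := L / Real.sqrt (4 * Real.pi * t) with ha_def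
  have ha : 0 < a := by positivity
  have h4 : 0 < 4 * Real.pi * t := by positivity
  have hsq : Real.sqrt (4 * Real.pi * t) ^ 2 = 4 * Real.pi * t := Real.sq_sqrt h4.le
  have ha2 : a ^ 2 = L ^ 2 / (4 * Real.pi * t) := by rw [ha_def, div_pow, hsq]
  rcases le_or_gt a (Real.pi / 2) with hsmall | hlarge
  · -- direct series with `c = 4π²t/L² = π/a²`
    set c : ℝ := 4 * Real.pi ^ 2 * t / L ^ 2 with hc_def
    have hc : 0 < c := by positivity
    have hlhs : (fun n : ℤ => Real.exp (-(t * (2 * Real.pi * n / L) ^ 2))) =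
        fun n : ℤ => Real.exp (-(c * (n : ℝ) ^ 2)) := by
      funext n; congr 1; rw [hc_def]; field_simp; ring
    rw [hlhs]
    refine (tsum_exp_neg_mul_intSq_le hc).trans ?_
    have h2c : 2 / c = 2 * a ^ 2 / Real.pi := by
      rw [ha2, hc_def]; field_simp
    rw [h2c]
    -- `2a²/π ≤ a` since `a ≤ π/2`
    have : 2 * a ^ 2 / Real.pi ≤ a := by
      rw [div_le_iff₀ hπ]; nlinarith
    linarith
  · -- Poisson side with `c = π a²`
    rw [torusTheta_poisson hL ht, ← ha_def]
    have hc : 0 < Real.pi * a ^ 2 := by positivity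
    have hb := tsum_exp_neg_mul_intSq_le hc
    have h2a : 2 / Real.pi ≤ a := by
      have : 2 / Real.pi ≤ Real.pi / 2 := by
        rw [div_le_div_iff₀ hπ two_pos]; nlinarith
      linarith
    calc a * ∑' n : ℤ, Real.exp (-(Real.pi * a ^ 2 * (n : ℝ) ^ 2))
        ≤ a * (1 + 2 / (Real.pi * a ^ 2)) := mul_le_mul_of_nonneg_left hb ha.le
      _ = a + 2 / Real.pi / a := by field_simp
      _ ≤ a + 1 := by
          have : 2 / Real.pi / a ≤ 1 := by
            rw [div_le_one ha]; exact h2a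
          linarith

/-! ### Bounds for `tr e^{tΔ}` on the three-torus -/

/-- `tr e^{tΔ} ≥ 1`. [folklore] -/
theorem one_le_torusHeatTrace {L t : ℝ} (hL : L ≠ 0) (ht : 0 < t) : 1 ≤ torusHeatTrace L t :=
  one_le_pow₀ (one_le_torusTheta hL ht)

/-- Sütő's lower bound `(L/√(4πt))³ ≤ tr e^{tΔ}` (units `ħ = 2m = 1`, `λ_B√j = √(4πjβ)`).
[cite: Suto2002, §2.1 (8)] -/
theorem div_sqrt_pow_le_torusHeatTrace {L t : ℝ} (hL : 0 < L) (ht : 0 < t) :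
    (L / Real.sqrt (4 * Real.pi * t)) ^ 3 ≤ torusHeatTrace L t :=
  pow_le_pow_left₀ (by positivity) (div_sqrt_le_torusTheta hL ht) 3

/-- Sütő's upper bound `tr e^{tΔ} ≤ (L/√(4πt) + 1)³`. [cite: Suto2002, §2.1 (8)] -/
theorem torusHeatTrace_le {L t : ℝ} (hL : 0 < L) (ht : 0 < t) :
    torusHeatTrace L t ≤ (L / Real.sqrt (4 * Real.pi * t) + 1) ^ 3 :=
  pow_le_pow_left₀ (tsum_nonneg fun _ => (Real.exp_pos _).le) (torusTheta_le hL ht) 3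

/-- `√(4πjβ) = λ_B √j` with `λ_B = √(4πβ)`. [folklore] -/
theorem sqrt_four_pi_mul (β : ℝ) {j : ℝ} (hj : 0 ≤ j) :
    Real.sqrt (4 * Real.pi * (j * β)) = thermalWavelength β * Real.sqrt j := by
  rw [thermalWavelength, ← Real.sqrt_mul' _ hj]
  ring_nf


/-! ### Asymptotics of `tr e^{-jβ(-Δ)} / L³` -/

/-- `λ_B > 0`. [folklore] -/
theorem thermalWavelength_pos {β : ℝ} (hβ : 0 < β) : 0 < thermalWavelength β := by
  unfold thermalWavelength
  exact Real.sqrt_pos.mpr (by positivity)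

/-- Two-sided bound in cycle form: `(L/(λ√j))³ ≤ tr e^{-jβT_{Λ,1}} ≤ (L/(λ√j) + 1)³`.
[cite: Suto2002, §2.1 (8)] -/
theorem torusHeatTrace_cycle_bounds {β L : ℝ} (hβ : 0 < β) (hL : 0 < L) {j : ℕ} (hj : 1 ≤ j) :
    (L / (thermalWavelength β * Real.sqrt j)) ^ 3 ≤ torusHeatTrace L (j * β) ∧
      torusHeatTrace L (j * β) ≤ (L / (thermalWavelength β * Real.sqrt j) + 1) ^ 3 := by
  have hjβ : 0 < (j : ℝ) * β := by positivity
  have := sqrt_four_pi_mul β (j := (j : ℝ)) (by positivity)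
  constructor
  · simpa [this] using div_sqrt_pow_le_torusHeatTrace hL hjβ
  · simpa [this] using torusHeatTrace_le hL hjβ

/-- For `L ≥ 1`, `j ≥ 1`: `tr e^{-jβT}/L³ ≤ (1/λ + 1)³` (a uniform bound). [folklore] -/
theorem torusHeatTrace_div_cube_le {β L : ℝ} (hβ : 0 < β) (hL : 1 ≤ L) {j : ℕ} (hj : 1 ≤ j) :
    torusHeatTrace L (j * β) / L ^ 3 ≤ (1 / thermalWavelength β + 1) ^ 3 := by
  have hlam := thermalWavelength_pos hβ
  have hL0 : 0 < L := by linarith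
  have hup := (torusHeatTrace_cycle_bounds hβ hL0 hj).2
  rw [div_le_iff₀ (by positivity)]
  refine hup.trans ?_
  rw [← mul_pow]
  apply pow_le_pow_left₀ (by positivity)
  rw [add_mul, one_mul]
  have hsj : 1 ≤ Real.sqrt j := by
    rw [Real.one_le_sqrt]; exact_mod_cast hj
  have h1 : L / (thermalWavelength β * Real.sqrt j) ≤ 1 / thermalWavelength β * L := by
    rw [div_le_iff₀ (by positivity)]
    have : 0 ≤ 1 / thermalWavelength β * L * thermalWavelength β * (Real.sqrt j - 1) := by
      have : 0 ≤ Real.sqrt j - 1 := by linarith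
      positivity
    have e : 1 / thermalWavelength β * L * thermalWavelength β = L := by field_simp
    nlinarith [e]
  linarith

/-- `tr e^{-jβT_{Λ,1}} / L³ → 1/(λ√j)³` as `L → ∞` (`j ≥ 1` fixed). [folklore] -/
theorem tendsto_torusHeatTrace_div_cube {β : ℝ} (hβ : 0 < β) {j : ℕ} (hj : 1 ≤ j) :
    Tendsto (fun L : ℝ => torusHeatTrace L (j * β) / L ^ 3) atTop
      (𝓝 ((thermalWavelength β * Real.sqrt j) ^ 3)⁻¹) := by
  have hlam := thermalWavelength_pos hβ
  set c := thermalWavelength β * Real.sqrt j with hc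
  have hcpos : 0 < c := by positivity
  have hup : Tendsto (fun L : ℝ => (1 / c + L⁻¹) ^ 3) atTop (𝓝 ((c ^ 3)⁻¹)) := by
    have : Tendsto (fun L : ℝ => (1 / c + L⁻¹) ^ 3) atTop (𝓝 ((1 / c + 0) ^ 3)) :=
      (tendsto_const_nhds.add tendsto_inv_atTop_zero).pow 3
    simpa using this
  refine tendsto_of_tendsto_of_tendsto_of_le_of_le' tendsto_const_nhds hup ?_ ?_
  · filter_upwards [eventually_gt_atTop 0] with L hL
    have := (torusHeatTrace_cycle_bounds hβ hL hj).1
    rw [le_div_iff₀ (by positivity)]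
    calc (c ^ 3)⁻¹ * L ^ 3 = (L / c) ^ 3 := by field_simp
      _ ≤ _ := this
  · filter_upwards [eventually_gt_atTop 0] with L hL
    have := (torusHeatTrace_cycle_bounds hβ hL hj).2
    rw [div_le_iff₀ (by positivity)]
    calc torusHeatTrace L (j * β) ≤ (L / c + 1) ^ 3 := this
      _ = (1 / c + L⁻¹) ^ 3 * L ^ 3 := by
          rw [← mul_pow]; congr 1; field_simp

/-- `∑_{j=1}^{M} f j = ∑_{i<M} f (i+1)`. [folklore] -/
theorem sum_Icc_one_eq_sum_range {M : Type*} [AddCommMonoid M] (f : ℕ → M) (n : ℕ) :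
    ∑ j ∈ Finset.Icc 1 n, f j = ∑ i ∈ Finset.range n, f (i + 1) := by
  have : Finset.Icc 1 n = Finset.Ico 1 (n + 1) := rfl
  rw [this, Finset.sum_Ico_eq_sum_range]
  refine Finset.sum_congr (by simp) fun k _ => ?_
  rw [add_comm 1 k]

/-- **Riemann-sum limit of the activity series.** For `0 ≤ x < 1`, `L_k → ∞` and `M_k → ∞`:
`L_k^{-3} ∑_{j=1}^{M_k} tr e^{-jβT_{Λ,1}} x^j → λ^{-3} ∑_{j≥1} x^j / j^{3/2}` (the density
`g_{3/2}(x)/λ_B³` of the grand-canonical free gas at activity `x`). [cite: Suto2002, §2.2 (28)] -/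
theorem tendsto_sum_torusHeatTrace_mul_pow {β x : ℝ} (hβ : 0 < β) (hx0 : 0 ≤ x) (hx1 : x < 1)
    {L : ℕ → ℝ} {M : ℕ → ℕ} (hL : Tendsto L atTop atTop) (hM : Tendsto M atTop atTop) :
    Tendsto (fun k => (∑ j ∈ Finset.Icc 1 (M k), torusHeatTrace (L k) (j * β) * x ^ j) / L k ^ 3)
      atTop (𝓝 ((∑' j : ℕ, x ^ (j + 1) / Real.sqrt ((j : ℝ) + 1) ^ 3) / thermalWavelength β ^ 3)) := by
  have hlam := thermalWavelength_pos hβ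
  set lamB := thermalWavelength β with hlamB
  -- the summands, extended by zero
  set F : ℕ → ℕ → ℝ := fun k i =>
    if i + 1 ≤ M k then torusHeatTrace (L k) ((i + 1 : ℕ) * β) * x ^ (i + 1) / L k ^ 3 else 0
    with hF
  set g : ℕ → ℝ := fun i => ((lamB * Real.sqrt ((i + 1 : ℕ) : ℝ)) ^ 3)⁻¹ * x ^ (i + 1) with hg
  set bound : ℕ → ℝ := fun i => (1 / lamB + 1) ^ 3 * x ^ i with hbound
  have h_sum : Summable bound := (summable_geometric_of_lt_one hx0 hx1).mul_left _
  have hab : ∀ i, Tendsto (fun k => F k i) atTop (𝓝 (g i)) := by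
    intro i
    have hlim := ((tendsto_torusHeatTrace_div_cube hβ (j := i + 1) (by omega)).comp hL).mul_const
      (x ^ (i + 1))
    refine hlim.congr' ?_
    filter_upwards [hM.eventually (eventually_ge_atTop (i + 1))] with k hk
    simp only [hF, Function.comp_apply, if_pos hk]
    ring
  have h_bound : ∀ᶠ k in atTop, ∀ i, ‖F k i‖ ≤ bound i := by
    filter_upwards [hL.eventually (eventually_ge_atTop 1)] with k hk i
    simp only [hF, hbound, Real.norm_eq_abs]
    split_ifs with h
    · rw [abs_of_nonneg (by
        have : 0 < L k := by linarith
        have := one_le_torusHeatTrace (L := L k) (t := ((i + 1 : ℕ) : ℝ) * β) this.ne'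
          (by positivity)
        positivity)]
      have h1 := torusHeatTrace_div_cube_le hβ hk (j := i + 1) (by omega)
      have h2 : x ^ (i + 1) ≤ x ^ i := pow_le_pow_of_le_one hx0 hx1.le (Nat.le_succ i)
      calc torusHeatTrace (L k) ((i + 1 : ℕ) * β) * x ^ (i + 1) / L k ^ 3
          = torusHeatTrace (L k) ((i + 1 : ℕ) * β) / L k ^ 3 * x ^ (i + 1) := by ring
        _ ≤ (1 / lamB + 1) ^ 3 * x ^ i :=
          mul_le_mul h1 h2 (pow_nonneg hx0 _) (by positivity)
    · simp only [abs_zero]; positivity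
  have hT := tendsto_tsum_of_dominated_convergence h_sum hab h_bound
  -- identify the two sides
  have hlhs : ∀ k, ∑' i, F k i =
      (∑ j ∈ Finset.Icc 1 (M k), torusHeatTrace (L k) (j * β) * x ^ j) / L k ^ 3 := by
    intro k
    rw [tsum_eq_sum (s := Finset.range (M k)) (fun i hi => by
      simp only [hF]; rw [if_neg]; simpa using hi)]
    rw [sum_Icc_one_eq_sum_range, Finset.sum_div]
    refine Finset.sum_congr rfl fun i hi => ?_
    have hi' : i + 1 ≤ M k := Finset.mem_range.mp hi
    simp only [hF, Nat.cast_add, Nat.cast_one]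
    rw [if_pos hi']
  have hrhs : ∑' i, g i = (∑' j : ℕ, x ^ (j + 1) / Real.sqrt ((j : ℝ) + 1) ^ 3) / lamB ^ 3 := by
    rw [← tsum_div_const]
    refine tsum_congr fun i => ?_
    simp only [hg, Nat.cast_add, Nat.cast_one, mul_pow]
    field_simp
  simpa only [hlhs, hrhs] using hT

/-! ### The sum `L^{-3} ∑_{j ≤ N} (tr e^{-jβT} - 1)` -/

/-- `∑_{j=1}^{N} 1/j ≤ 1 + log N` (`N ≥ 1`). [folklore] -/
theorem sum_Icc_inv_le_log {N : ℕ} (hN : 1 ≤ N) :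
    ∑ j ∈ Finset.Icc 1 N, (1 : ℝ) / j ≤ 1 + Real.log N := by
  induction N, hN using Nat.le_induction with
  | base => simp
  | succ n hn ih =>
    rw [Finset.sum_Icc_succ_top (by omega), Nat.cast_succ]
    have hn0 : (0 : ℝ) < n := by exact_mod_cast hn
    have hlog : Real.log n + 1 / ((n : ℝ) + 1) ≤ Real.log ((n : ℝ) + 1) := by
      have h := Real.log_le_sub_one_of_pos (show (0 : ℝ) < n / (n + 1) by positivity)
      rw [Real.log_div hn0.ne' (by positivity)] at h
      have e : (n : ℝ) / (n + 1) - 1 = -(1 / (n + 1)) := by field_simp; ring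
      linarith
    linarith

/-- `∑_{j=1}^{N} 1/√j ≤ 2√N`. [folklore] -/
theorem sum_Icc_inv_sqrt_le (N : ℕ) :
    ∑ j ∈ Finset.Icc 1 N, 1 / Real.sqrt j ≤ 2 * Real.sqrt N := by
  induction N with
  | zero => simp
  | succ n ih =>
    rw [Finset.sum_Icc_succ_top (by omega), Nat.cast_succ]
    set s := Real.sqrt ((n : ℝ) + 1) with hs
    set r := Real.sqrt (n : ℝ) with hr
    have hs2 : s ^ 2 = n + 1 := Real.sq_sqrt (by positivity)
    have hr2 : r ^ 2 = n := Real.sq_sqrt (by positivity)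
    have hspos : 0 < s := Real.sqrt_pos.mpr (by positivity)
    have hr0 : 0 ≤ r := Real.sqrt_nonneg _
    have key : 1 / s ≤ 2 * (s - r) := by
      rw [div_le_iff₀ hspos]
      nlinarith [sq_nonneg (s - r)]
    linarith

/-- `√y³ = y^{3/2}` for `y ≥ 0`. [folklore] -/
theorem sqrt_pow_three {y : ℝ} (hy : 0 ≤ y) : Real.sqrt y ^ 3 = y ^ (3 / 2 : ℝ) := by
  rw [Real.sqrt_eq_rpow, ← Real.rpow_natCast, ← Real.rpow_mul hy]
  norm_num

/-- `∑_{j≥1} 1/j^{3/2}` converges (written with `√j³`). [folklore] -/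
theorem summable_inv_sqrt_cube :
    Summable fun j : ℕ => 1 / Real.sqrt ((j : ℝ) + 1) ^ 3 := by
  have h := (Real.summable_one_div_nat_rpow.mpr (by norm_num : (1 : ℝ) < 3 / 2))
  have h' := (summable_nat_add_iff 1).mpr h
  refine h'.congr fun j => ?_
  simp only [Nat.cast_add, Nat.cast_one]
  rw [sqrt_pow_three (by positivity)]

/-- **Upper bound for `L^{-3}∑_{j≤N}(tr e^{-jβT} - 1)`** from `tr e^{-jβT} ≤ (a_j+1)³`,
`(a+1)³ - 1 = a³ + 3a² + 3a`, `∑ 1/j ≤ 1 + log N`, `∑ 1/√j ≤ 2√N`. [folklore] -/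
theorem sum_torusHeatTrace_sub_one_div_le {β L : ℝ} (hβ : 0 < β) (hL : 1 ≤ L) {N : ℕ}
    (hN : 1 ≤ N) :
    (∑ j ∈ Finset.Icc 1 N, (torusHeatTrace L (j * β) - 1)) / L ^ 3 ≤
      (∑' j : ℕ, 1 / Real.sqrt ((j : ℝ) + 1) ^ 3) / thermalWavelength β ^ 3 +
        3 * (1 + Real.log N) / (thermalWavelength β ^ 2 * L) +
        6 * Real.sqrt N / (thermalWavelength β * L ^ 2) := by
  have hlam := thermalWavelength_pos hβ
  set lamB := thermalWavelength β with hlamB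
  have hL0 : 0 < L := by linarith
  -- termwise bound
  have hterm : ∀ j ∈ Finset.Icc 1 N, (torusHeatTrace L (j * β) - 1) / L ^ 3 ≤
      1 / (lamB * Real.sqrt j) ^ 3 + 3 / (lamB ^ 2 * L) * (1 / j) + 3 / (lamB * L ^ 2) * (1 / Real.sqrt j) := by
    intro j hj
    have hj1 : 1 ≤ j := (Finset.mem_Icc.mp hj).1
    have hjpos : (0 : ℝ) < j := by exact_mod_cast hj1
    have hsj : 0 < Real.sqrt j := Real.sqrt_pos.mpr hjpos
    have hsq : Real.sqrt j ^ 2 = j := Real.sq_sqrt hjpos.le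
    have hup := (torusHeatTrace_cycle_bounds hβ hL0 hj1).2
    rw [div_le_iff₀ (by positivity)]
    set a := L / (lamB * Real.sqrt j) with ha
    have ha0 : 0 < a := by positivity
    calc torusHeatTrace L (j * β) - 1 ≤ (a + 1) ^ 3 - 1 := by linarith
      _ = a ^ 3 + 3 * a ^ 2 + 3 * a := by ring
      _ = (1 / (lamB * Real.sqrt j) ^ 3 + 3 / (lamB ^ 2 * L) * (1 / j) +
            3 / (lamB * L ^ 2) * (1 / Real.sqrt j)) * L ^ 3 := by
          rw [ha, show (1 : ℝ) / j = 1 / Real.sqrt j ^ 2 by rw [hsq]]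
          field_simp
  calc (∑ j ∈ Finset.Icc 1 N, (torusHeatTrace L (j * β) - 1)) / L ^ 3
      = ∑ j ∈ Finset.Icc 1 N, (torusHeatTrace L (j * β) - 1) / L ^ 3 := Finset.sum_div _ _ _
    _ ≤ ∑ j ∈ Finset.Icc 1 N, (1 / (lamB * Real.sqrt j) ^ 3 + 3 / (lamB ^ 2 * L) * (1 / j) +
          3 / (lamB * L ^ 2) * (1 / Real.sqrt j)) := Finset.sum_le_sum hterm
    _ = ∑ j ∈ Finset.Icc 1 N, 1 / (lamB * Real.sqrt j) ^ 3 +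
          3 / (lamB ^ 2 * L) * ∑ j ∈ Finset.Icc 1 N, (1 : ℝ) / j +
          3 / (lamB * L ^ 2) * ∑ j ∈ Finset.Icc 1 N, 1 / Real.sqrt j := by
        rw [Finset.sum_add_distrib, Finset.sum_add_distrib, Finset.mul_sum, Finset.mul_sum]
    _ ≤ (∑' j : ℕ, 1 / Real.sqrt ((j : ℝ) + 1) ^ 3) / lamB ^ 3 +
          3 / (lamB ^ 2 * L) * (1 + Real.log N) + 3 / (lamB * L ^ 2) * (2 * Real.sqrt N) := by
        gcongr
        · -- partial sum ≤ full sum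
          rw [sum_Icc_one_eq_sum_range, ← tsum_div_const]
          have hs : Summable fun i : ℕ => 1 / Real.sqrt ((i : ℝ) + 1) ^ 3 / lamB ^ 3 :=
            summable_inv_sqrt_cube.div_const _
          have heq : ∀ i : ℕ, 1 / (lamB * Real.sqrt ((i + 1 : ℕ) : ℝ)) ^ 3 =
              1 / Real.sqrt ((i : ℝ) + 1) ^ 3 / lamB ^ 3 := by
            intro i; push_cast; rw [mul_pow]; field_simp
          simp only [heq]
          exact hs.sum_le_tsum (Finset.range N) fun i _ => by positivity
        · exact sum_Icc_inv_le_log hN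
        · exact sum_Icc_inv_sqrt_le N
    _ = _ := by ring

/-- **The excited-mode sum is asymptotically at most `ρ_c`**: along `L_k → ∞` with
`N_k ≤ C L_k³`, for every `ε > 0` eventually
`L_k^{-3} ∑_{j ≤ N_k} (tr e^{-jβT} - 1) ≤ ζ(3/2)/λ_B³ + ε`. [folklore] -/
theorem eventually_sum_torusHeatTrace_sub_one_le {β : ℝ} (hβ : 0 < β) {L : ℕ → ℝ} {N : ℕ → ℕ}
    (hL : Tendsto L atTop atTop) {C : ℝ} (hC : 0 < C) (hN : ∀ᶠ k in atTop, (N k : ℝ) ≤ C * L k ^ 3)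
    {ε : ℝ} (hε : 0 < ε) :
    ∀ᶠ k in atTop, (∑ j ∈ Finset.Icc 1 (N k), (torusHeatTrace (L k) (j * β) - 1)) / L k ^ 3 ≤
      (∑' j : ℕ, 1 / Real.sqrt ((j : ℝ) + 1) ^ 3) / thermalWavelength β ^ 3 + ε := by
  have hlam := thermalWavelength_pos hβ
  set lamB := thermalWavelength β with hlamB
  -- the error majorant as a function of `L`
  set E : ℝ → ℝ := fun l =>
    3 * (1 + (|Real.log C| + 3 * (2 * Real.sqrt l))) / lamB ^ 2 * l⁻¹ +
      6 * Real.sqrt C / lamB * (Real.sqrt l)⁻¹ with hE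
  have hE0 : Tendsto E atTop (𝓝 0) := by
    have h1 : Tendsto (fun l : ℝ => (Real.sqrt l)⁻¹) atTop (𝓝 0) :=
      tendsto_inv_atTop_zero.comp Real.tendsto_sqrt_atTop
    have h2 : Tendsto (fun l : ℝ => Real.sqrt l * l⁻¹) atTop (𝓝 0) := by
      refine h1.congr' ?_
      filter_upwards [eventually_gt_atTop 0] with l hl
      have hs : Real.sqrt l ≠ 0 := (Real.sqrt_pos.mpr hl).ne'
      field_simp
      rw [Real.sq_sqrt hl.le]
    have h3 : Tendsto (fun l : ℝ => 3 * (1 + (|Real.log C| + 3 * (2 * Real.sqrt l))) / lamB ^ 2 * l⁻¹)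
        atTop (𝓝 0) := by
      have : (fun l : ℝ => 3 * (1 + (|Real.log C| + 3 * (2 * Real.sqrt l))) / lamB ^ 2 * l⁻¹) =
          fun l => 3 * (1 + |Real.log C|) / lamB ^ 2 * l⁻¹ + 18 / lamB ^ 2 * (Real.sqrt l * l⁻¹) := by
        funext l; ring
      rw [this]
      simpa using (tendsto_inv_atTop_zero.const_mul (3 * (1 + |Real.log C|) / lamB ^ 2)).add
        (h2.const_mul (18 / lamB ^ 2))
    simpa [hE] using h3.add (h1.const_mul (6 * Real.sqrt C / lamB))
  have hEε : ∀ᶠ k in atTop, E (L k) < ε :=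
    (hE0.comp hL).eventually (gt_mem_nhds hε)
  filter_upwards [hEε, hN, hL.eventually (eventually_ge_atTop 1)] with k hk hNk hLk
  have hL0 : 0 < L k := by linarith
  rcases Nat.eq_zero_or_pos (N k) with h0 | hN1
  · simp only [h0]
    simp only [show Finset.Icc 1 0 = ∅ by rfl, Finset.sum_empty, zero_div]
    positivity
  have hmain := sum_torusHeatTrace_sub_one_div_le hβ hLk (N := N k) hN1
  -- bound the error terms by `E (L k)`
  have hNpos : (0 : ℝ) < N k := by exact_mod_cast hN1
  have hlogN : Real.log (N k) ≤ |Real.log C| + 3 * (2 * Real.sqrt (L k)) := by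
    have h1 : Real.log (N k) ≤ Real.log (C * L k ^ 3) := Real.log_le_log hNpos hNk
    rw [Real.log_mul hC.ne' (by positivity), Real.log_pow] at h1
    -- `log L ≤ 2√L` (`log √L ≤ √L - 1`)
    have h2 : Real.log (L k) ≤ 2 * Real.sqrt (L k) := by
      have h := Real.log_le_sub_one_of_pos (Real.sqrt_pos.mpr hL0)
      rw [Real.log_sqrt hL0.le] at h
      linarith [Real.sqrt_nonneg (L k)]
    have h3 := le_abs_self (Real.log C)
    push_cast at h1
    linarith
  set s := Real.sqrt (L k) with hs_def
  have hs0 : 0 < s := Real.sqrt_pos.mpr hL0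
  have hLs : L k = s ^ 2 := (Real.sq_sqrt hL0.le).symm
  have hsqrtN : Real.sqrt (N k) ≤ Real.sqrt C * (s ^ 2 * s) := by
    calc Real.sqrt (N k) ≤ Real.sqrt (C * L k ^ 3) := Real.sqrt_le_sqrt (by linarith [hNk])
      _ = Real.sqrt C * (s ^ 2 * s) := by
          rw [show C * L k ^ 3 = C * (L k ^ 2 * L k) by ring, Real.sqrt_mul hC.le,
            Real.sqrt_mul (sq_nonneg _), Real.sqrt_sq hL0.le, hs_def, ← hLs]
  have herr : 3 * (1 + Real.log (N k)) / (lamB ^ 2 * L k) + 6 * Real.sqrt (N k) / (lamB * L k ^ 2) ≤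
      E (L k) := by
    simp only [hE]
    rw [← hs_def]
    have e1 : 3 * (1 + Real.log (N k)) / (lamB ^ 2 * L k) ≤
        3 * (1 + (|Real.log C| + 3 * (2 * s))) / lamB ^ 2 * (L k)⁻¹ := by
      rw [div_eq_mul_inv, mul_inv, ← mul_assoc, ← div_eq_mul_inv _ (lamB ^ 2)]
      gcongr
    have e2 : 6 * Real.sqrt (N k) / (lamB * L k ^ 2) ≤ 6 * Real.sqrt C / lamB * s⁻¹ := by
      rw [hLs]
      calc 6 * Real.sqrt (N k) / (lamB * (s ^ 2) ^ 2)
          ≤ 6 * (Real.sqrt C * (s ^ 2 * s)) / (lamB * (s ^ 2) ^ 2) := by gcongr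
        _ = 6 * Real.sqrt C / lamB * s⁻¹ := by field_simp
    linarith
  linarith

/-! ### The Bose function `g(x) = ∑_{j≥1} x^j / j^{3/2}` on `[0,1]` -/

/-- The terms `x^j/j^{3/2}` are dominated by `1/j^{3/2}` on `[0,1]`. [folklore] -/
theorem boseTerm_le {x : ℝ} (hx0 : 0 ≤ x) (hx1 : x ≤ 1) (j : ℕ) :
    x ^ (j + 1) / Real.sqrt ((j : ℝ) + 1) ^ 3 ≤ 1 / Real.sqrt ((j : ℝ) + 1) ^ 3 :=
  div_le_div_of_nonneg_right (pow_le_one₀ hx0 hx1) (by positivity)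

/-- `g(x)` converges for `0 ≤ x ≤ 1`. [folklore] -/
theorem summable_boseTerm {x : ℝ} (hx0 : 0 ≤ x) (hx1 : x ≤ 1) :
    Summable fun j : ℕ => x ^ (j + 1) / Real.sqrt ((j : ℝ) + 1) ^ 3 :=
  Summable.of_nonneg_of_le (fun j => by positivity) (boseTerm_le hx0 hx1) summable_inv_sqrt_cube

/-- `g(0) = 0`. [folklore] -/
theorem boseFun_zero : ∑' j : ℕ, (0 : ℝ) ^ (j + 1) / Real.sqrt ((j : ℝ) + 1) ^ 3 = 0 := by
  simp

/-- `g(1) = ∑_{j ≥ 1} j^{-3/2}` (`= ζ(3/2)`), in the form used by `criticalDensity`. [folklore] -/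
theorem boseFun_one :
    ∑' j : ℕ, (1 : ℝ) ^ (j + 1) / Real.sqrt ((j : ℝ) + 1) ^ 3 =
      ∑' j : ℕ, 1 / ((j + 1 : ℝ) ^ (3 / 2 : ℝ)) := by
  refine tsum_congr fun j => ?_
  rw [one_pow, sqrt_pow_three (by positivity)]

/-- `g` is nondecreasing on `[0,1]`. [folklore] -/
theorem boseFun_mono {x y : ℝ} (hx0 : 0 ≤ x) (hxy : x ≤ y) (hy1 : y ≤ 1) :
    ∑' j : ℕ, x ^ (j + 1) / Real.sqrt ((j : ℝ) + 1) ^ 3 ≤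
      ∑' j : ℕ, y ^ (j + 1) / Real.sqrt ((j : ℝ) + 1) ^ 3 :=
  (summable_boseTerm hx0 (hxy.trans hy1)).tsum_le_tsum
    (fun j => div_le_div_of_nonneg_right (pow_le_pow_left₀ hx0 hxy _) (by positivity))
    (summable_boseTerm (hx0.trans hxy) hy1)

/-- `g` is strictly increasing on `[0,1]`. [folklore] -/
theorem boseFun_strictMono {x y : ℝ} (hx0 : 0 ≤ x) (hxy : x < y) (hy1 : y ≤ 1) :
    ∑' j : ℕ, x ^ (j + 1) / Real.sqrt ((j : ℝ) + 1) ^ 3 <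
      ∑' j : ℕ, y ^ (j + 1) / Real.sqrt ((j : ℝ) + 1) ^ 3 := by
  refine (summable_boseTerm hx0 (hxy.le.trans hy1)).tsum_lt_tsum (i := 0)
    (fun j => div_le_div_of_nonneg_right (pow_le_pow_left₀ hx0 hxy.le _) (by positivity)) ?_
    (summable_boseTerm (hx0.trans hxy.le) hy1)
  simpa using hxy

/-- `g` is continuous on `[0,1]` (uniformly convergent series). [folklore] -/
theorem continuousOn_boseFun :
    ContinuousOn (fun x : ℝ => ∑' j : ℕ, x ^ (j + 1) / Real.sqrt ((j : ℝ) + 1) ^ 3)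
      (Set.Icc 0 1) := by
  refine continuousOn_tsum (fun j => ?_) summable_inv_sqrt_cube fun j x hx => ?_
  · exact ((continuous_pow (j + 1)).div_const _).continuousOn
  · rw [Real.norm_eq_abs, abs_of_nonneg (by have := hx.1; positivity)]
    exact boseTerm_le hx.1 hx.2 j

/-- Partial sums of `g`. [folklore] -/
theorem tendsto_sum_range_boseTerm {x : ℝ} (hx0 : 0 ≤ x) (hx1 : x ≤ 1) :
    Tendsto (fun J => ∑ j ∈ Finset.range J, x ^ (j + 1) / Real.sqrt ((j : ℝ) + 1) ^ 3) atTop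
      (𝓝 (∑' j : ℕ, x ^ (j + 1) / Real.sqrt ((j : ℝ) + 1) ^ 3)) :=
  (summable_boseTerm hx0 hx1).hasSum.tendsto_sum_nat

/-- **The saturated activity.** For every `y > 0` there is `ζ ∈ (0,1]` with
`g(ζ) = min(y, g(1))`: the thermodynamic-limit activity of the free Bose gas at
`ρλ_B³ = y` (`ζ < 1` solves `g(ζ) = y` below the critical density, `ζ = 1` above it).
[cite: Suto2002, §2.2 (28)–(30)] -/
theorem exists_saturatedActivity {y : ℝ} (hy : 0 < y) :
    ∃ ζ : ℝ, 0 < ζ ∧ ζ ≤ 1 ∧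
      ∑' j : ℕ, ζ ^ (j + 1) / Real.sqrt ((j : ℝ) + 1) ^ 3 =
        min y (∑' j : ℕ, (1 : ℝ) ^ (j + 1) / Real.sqrt ((j : ℝ) + 1) ^ 3) := by
  set g : ℝ → ℝ := fun x => ∑' j : ℕ, x ^ (j + 1) / Real.sqrt ((j : ℝ) + 1) ^ 3 with hg
  rcases lt_or_ge y (g 1) with hlt | hge
  · -- intermediate value theorem on `[0,1]`
    have hivt := intermediate_value_Ioo (zero_le_one' ℝ) continuousOn_boseFun
    have hy' : y ∈ Set.Ioo (g 0) (g 1) := ⟨by rw [hg]; simpa using hy, hlt⟩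
    obtain ⟨ζ, ⟨hζ0, hζ1⟩, hζ⟩ := hivt hy'
    exact ⟨ζ, hζ0, hζ1.le, by rw [min_eq_left hlt.le]; exact hζ⟩
  · exact ⟨1, one_pos, le_rfl, by rw [min_eq_right hge]⟩

/-- Below the saturated activity the Bose function is below `y`. [folklore] -/
theorem boseFun_lt_of_lt_saturated {y ζ x : ℝ} (hζ1 : ζ ≤ 1)
    (hζ : ∑' j : ℕ, ζ ^ (j + 1) / Real.sqrt ((j : ℝ) + 1) ^ 3 =
      min y (∑' j : ℕ, (1 : ℝ) ^ (j + 1) / Real.sqrt ((j : ℝ) + 1) ^ 3))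
    (hx0 : 0 ≤ x) (hx : x < ζ) :
    ∑' j : ℕ, x ^ (j + 1) / Real.sqrt ((j : ℝ) + 1) ^ 3 < y :=
  lt_of_lt_of_le (boseFun_strictMono hx0 hx hζ1) (hζ ▸ min_le_left _ _)

/-- Above a non-saturated activity (`ζ < 1`) the Bose function exceeds `y`. [folklore] -/
theorem lt_boseFun_of_saturated_lt {y ζ x : ℝ} (hζ0 : 0 ≤ ζ) (hζ1 : ζ < 1)
    (hζ : ∑' j : ℕ, ζ ^ (j + 1) / Real.sqrt ((j : ℝ) + 1) ^ 3 =
      min y (∑' j : ℕ, (1 : ℝ) ^ (j + 1) / Real.sqrt ((j : ℝ) + 1) ^ 3))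
    (hx : ζ < x) (hx1 : x ≤ 1) :
    y < ∑' j : ℕ, x ^ (j + 1) / Real.sqrt ((j : ℝ) + 1) ^ 3 := by
  have hlt1 : ∑' j : ℕ, ζ ^ (j + 1) / Real.sqrt ((j : ℝ) + 1) ^ 3 <
      ∑' j : ℕ, (1 : ℝ) ^ (j + 1) / Real.sqrt ((j : ℝ) + 1) ^ 3 :=
    boseFun_strictMono hζ0 hζ1 le_rfl
  have hy : y = ∑' j : ℕ, ζ ^ (j + 1) / Real.sqrt ((j : ℝ) + 1) ^ 3 := by
    rcases le_total y (∑' j : ℕ, (1 : ℝ) ^ (j + 1) / Real.sqrt ((j : ℝ) + 1) ^ 3) with h | h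
    · rw [hζ, min_eq_left h]
    · rw [min_eq_right h] at hζ; exact absurd hζ hlt1.ne
  rw [hy]
  exact boseFun_strictMono hζ0 hx hx1

open Literature.MathematicalPhysics.QuantumManyBody.BoseGas (sideLength)


/-! ### The canonical partition function: recursion, monotonicity, log-concavity -/

/-- **Sütő's recursion** `N Q_{Λ,N} = ∑_{j=1}^{N} tr e^{-jβT_{Λ,1}} Q_{Λ,N-j}`, i.e.
`∑_j P_{Λ,N}(ξ₁ = j) = 1`. [cite: Suto2002, §1 (4)–(5), §2.1 (7), (10)] -/
theorem canonicalZ_rec (β L : ℝ) (N : ℕ) :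
    (N : ℝ) * canonicalZ β L N =
      ∑ j ∈ Finset.Icc 1 N, torusHeatTrace L (j * β) * canonicalZ β L (N - j) :=
  partitionSum_rec (fun j => torusHeatTrace L (j * β)) N

/-- `Q_{Λ,N}` is nondecreasing in `N` (`Q_{Λ,N-j} < Q_{Λ,N}` in [Suto2002, §2.1 after (10)];
`Prob(n₀ ≥ i) = Y(N-i)/Y(N) ≤ 1` in [Ueltschi2006, App. B]): peel off the zero mode.
[cite: Suto2002, §2.1 (10)–(11)] -/
theorem canonicalZ_monotone {β L : ℝ} (hβ : 0 < β) (hL : L ≠ 0) : Monotone (canonicalZ β L) := by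
  obtain ⟨Z', hZ'0, hZ'⟩ := exists_cycleSol (fun j => torusHeatTrace L (j * β) - 1)
  refine cycleSol_monotone (canonicalZ_zero β L) (canonicalZ_rec β L) hZ'0 hZ' (fun j _ => by ring)
    fun j hj => ?_
  have : 0 < (j : ℝ) * β := by positivity
  linarith [one_le_torusHeatTrace hL this]

/-- `(∑_{m} y_m)³ = ∑_{(a,b,c)} y_a y_b y_c` over a product of three copies of a finset.
[folklore] -/
theorem sum_pow_three_eq_sum_prod {ι : Type*} (s : Finset ι) (f : ι → ℝ) :
    (∑ m ∈ s, f m) ^ 3 = ∑ n ∈ s ×ˢ s ×ˢ s, f n.1 * f n.2.1 * f n.2.2 := by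
  conv_rhs => rw [Finset.sum_product]
  simp only [Finset.sum_product]
  rw [pow_succ, pow_two, Finset.sum_mul_sum, Finset.sum_mul]
  refine Finset.sum_congr rfl fun a _ => ?_
  rw [Finset.sum_mul]
  refine Finset.sum_congr rfl fun b _ => ?_
  rw [Finset.mul_sum]

/-- Symmetric partial sums over `[-R, R]` converge to the sum over `ℤ`. [folklore] -/
theorem tendsto_sum_Icc_neg_of_summable {f : ℤ → ℝ} (hf : Summable f) :
    Tendsto (fun R : ℕ => ∑ m ∈ Finset.Icc (-(R : ℤ)) R, f m) atTop (𝓝 (∑' m, f m)) := by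
  have h := hf.hasSum
  rw [HasSum] at h
  refine h.comp (tendsto_atTop_finset_of_monotone (fun a b hab => ?_) fun m => ?_)
  · exact Finset.Icc_subset_Icc (by simpa using hab) (by simpa using hab)
  · refine ⟨m.natAbs, Finset.mem_Icc.mpr ⟨?_, ?_⟩⟩ <;> omega

/-- **Log-concavity of the canonical partition function**: `Q_{Λ,N} Q_{Λ,N+2} ≤ Q_{Λ,N+1}²`
(the `Q_{Λ,N}` are complete homogeneous symmetric functions of the Boltzmann weights
`e^{-βε_k}`, `k ∈ (2π/L)ℤ³`; finite truncations are log-concave by `cycleSol_logConcave_finset`).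
[folklore] -/
theorem canonicalZ_logConcave {β L : ℝ} (hβ : 0 < β) (hL : 0 < L) (n : ℕ) :
    canonicalZ β L n * canonicalZ β L (n + 2) ≤ canonicalZ β L (n + 1) ^ 2 := by
  -- one-dimensional Boltzmann weights
  set y : ℤ → ℝ := fun m => Real.exp (-(β * (2 * Real.pi * m / L) ^ 2)) with hy
  have hypos : ∀ m, 0 < y m := fun m => Real.exp_pos _
  have hyj : ∀ (j : ℕ) (m : ℤ), y m ^ j = Real.exp (-((j : ℝ) * β * (2 * Real.pi * m / L) ^ 2)) := by
    intro j m
    rw [hy, ← Real.exp_nat_mul]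
    congr 1; ring
  -- truncated weights (the irrelevant weight `j = 0` is frozen at its limit value)
  set x : ℤ × ℤ × ℤ → ℝ := fun p => y p.1 * y p.2.1 * y p.2.2 with hx
  set S : ℕ → Finset (ℤ × ℤ × ℤ) := fun R =>
    Finset.Icc (-(R : ℤ)) R ×ˢ Finset.Icc (-(R : ℤ)) R ×ˢ Finset.Icc (-(R : ℤ)) R with hS
  set A : ℕ → ℕ → ℝ := fun R j =>
    if j = 0 then torusHeatTrace L ((0 : ℕ) * β) else ∑ p ∈ S R, x p ^ j with hA
  have hSne : ∀ R, (S R).Nonempty := fun R => ⟨(0, 0, 0), by simp [hS]⟩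
  have hxpos : ∀ R, ∀ p ∈ S R, 0 < x p := fun R p _ => by
    simp only [hx]; exact mul_pos (mul_pos (hypos _) (hypos _)) (hypos _)
  -- solutions of the truncated recursions and their log-concavity
  set ZA : ℕ → ℕ → ℝ := fun R => Classical.choose (exists_cycleSol (A R)) with hZA_def
  have hZA0 : ∀ R, ZA R 0 = 1 := fun R => (Classical.choose_spec (exists_cycleSol (A R))).1
  have hZA : ∀ R (n : ℕ), (n : ℝ) * ZA R n = ∑ j ∈ Finset.Icc 1 n, A R j * ZA R (n - j) :=
    fun R => (Classical.choose_spec (exists_cycleSol (A R))).2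
  have hlc : ∀ R n, ZA R n * ZA R (n + 2) ≤ ZA R (n + 1) ^ 2 := by
    intro R
    refine (cycleSol_logConcave_finset x (hSne R) (hxpos R) (ZA R) (hZA0 R) fun n => ?_).2
    refine cycleSol_congr (hZA R) (fun j hj => ?_) n
    simp [hA, Nat.one_le_iff_ne_zero.mp hj]
  -- convergence of the truncated weights
  have hlim : ∀ j, Tendsto (fun R => A R j) atTop (𝓝 (torusHeatTrace L (j * β))) := by
    intro j
    rcases Nat.eq_zero_or_pos j with rfl | hj
    · simp only [hA, if_pos rfl]
      exact tendsto_const_nhds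
    · have hAeq : ∀ R, A R j = (∑ m ∈ Finset.Icc (-(R : ℤ)) R, y m ^ j) ^ 3 := by
        intro R
        simp only [hA, if_neg hj.ne']
        rw [sum_pow_three_eq_sum_prod]
        refine Finset.sum_congr rfl fun p _ => ?_
        simp only [hx, mul_pow]
      simp only [hAeq]
      unfold torusHeatTrace
      refine Tendsto.pow ?_ 3
      have hsum : Summable fun m : ℤ => Real.exp (-((j : ℝ) * β * (2 * Real.pi * m / L) ^ 2)) :=
        summable_torusHeat hL.ne' (by positivity)
      simpa only [hyj] using tendsto_sum_Icc_neg_of_summable hsum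
  exact cycleSol_logConcave_of_tendsto hZA0 hZA (canonicalZ_zero β L) (canonicalZ_rec β L) hlim hlc n

/-! ### Ratios `Q_{Λ,M}/Q_{Λ,M+1}` (the canonical activity) -/

/-- Index bookkeeping for `div_le_ratio_pow`: `Z_{M+1-j}/Z_{M+1} ≤ (Z_M/Z_{M+1})^j` for
`1 ≤ j ≤ M+1`. [folklore] -/
theorem div_le_ratio_pow' {Z : ℕ → ℝ} (hpos : ∀ n, 0 < Z n)
    (hlc : ∀ n, Z n * Z (n + 2) ≤ Z (n + 1) ^ 2) {M j : ℕ} (hj1 : 1 ≤ j) (hjM : j ≤ M + 1) :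
    Z (M + 1 - j) / Z (M + 1) ≤ (Z M / Z (M + 1)) ^ j := by
  obtain ⟨i, rfl⟩ : ∃ i, j = i + 1 := ⟨j - 1, by omega⟩
  have h := div_le_ratio_pow hpos hlc (M - i) i
  have e1 : M - i + (i + 1) = M + 1 := by omega
  have e2 : M - i + i = M := by omega
  have e3 : M + 1 - (i + 1) = M - i := by omega
  rw [e1, e2] at h
  rw [e3]
  exact h

/-- Index bookkeeping for `ratio_pow_le_div`: `(Z_{M-j}/Z_{M-j+1})^j ≤ Z_{M-j}/Z_M` for `j ≤ M`.
[folklore] -/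
theorem ratio_pow_le_div' {Z : ℕ → ℝ} (hpos : ∀ n, 0 < Z n)
    (hlc : ∀ n, Z n * Z (n + 2) ≤ Z (n + 1) ^ 2) {M j : ℕ} (hjM : j ≤ M) :
    (Z (M - j) / Z (M - j + 1)) ^ j ≤ Z (M - j) / Z M := by
  have h := ratio_pow_le_div hpos hlc (M - j) j
  rwa [Nat.sub_add_cancel hjM] at h

/-- The recursion divided by `Q_{Λ,N}`: `∑_{j=1}^{N} tr e^{-jβT} Q_{Λ,N-j}/Q_{Λ,N} = N`
(`= ∑_j N P_{Λ,N}(ξ₁=j)`). [cite: Suto2002, §1 (4)–(5), §2.1 (10)] -/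
theorem sum_torusHeatTrace_mul_ratio {β L : ℝ} (hβ : 0 < β) (hL : L ≠ 0) (N : ℕ) :
    ∑ j ∈ Finset.Icc 1 N, torusHeatTrace L (j * β) * (canonicalZ β L (N - j) / canonicalZ β L N) =
      N := by
  have hQ := canonicalZ_pos hβ hL N
  have h := canonicalZ_rec β L N
  rw [eq_comm, ← div_eq_iff hQ.ne'] at h
  rw [← h, Finset.sum_div]
  refine Finset.sum_congr rfl fun j _ => ?_
  ring

/-! ### The thermodynamic sequence `L_N = (N/ρ)^{1/3}` -/

/-- `L_N³ = N/ρ`. [folklore] -/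
theorem sideLength_pow_three {ρ : ℝ} (hρ : 0 < ρ) (N : ℕ) : sideLength ρ N ^ 3 = N / ρ := by
  unfold Literature.MathematicalPhysics.QuantumManyBody.BoseGas.sideLength
  rw [← Real.rpow_natCast, ← Real.rpow_mul (by positivity)]
  norm_num

/-- `L_N > 0` for `N ≥ 1`. [folklore] -/
theorem sideLength_pos {ρ : ℝ} (hρ : 0 < ρ) {N : ℕ} (hN : 1 ≤ N) : 0 < sideLength ρ N := by
  unfold Literature.MathematicalPhysics.QuantumManyBody.BoseGas.sideLength
  exact Real.rpow_pos_of_pos (by positivity) _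

/-- `L_N → ∞`. [folklore] -/
theorem tendsto_sideLength {ρ : ℝ} (hρ : 0 < ρ) : Tendsto (fun N => sideLength ρ N) atTop atTop := by
  unfold Literature.MathematicalPhysics.QuantumManyBody.BoseGas.sideLength
  exact (tendsto_rpow_atTop (by norm_num : (0 : ℝ) < 1 / 3)).comp
    (tendsto_natCast_atTop_atTop.atTop_div_const hρ)

/-! ### The canonical activity converges to the saturated activity (key lemma) -/

section Activity

variable {β : ℝ} (hβ : 0 < β) {L : ℕ → ℝ} (hL : Tendsto L atTop atTop) {M : ℕ → ℕ} {ρ' : ℝ}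
  (hρ' : 0 < ρ') (hM : Tendsto (fun k => (M k : ℝ) / L k ^ 3) atTop (𝓝 ρ')) {ζ : ℝ}
  (hζ0 : 0 < ζ) (hζ1 : ζ ≤ 1)
  (hζ : ∑' j : ℕ, ζ ^ (j + 1) / Real.sqrt ((j : ℝ) + 1) ^ 3 =
    min (ρ' * thermalWavelength β ^ 3) (∑' j : ℕ, (1 : ℝ) ^ (j + 1) / Real.sqrt ((j : ℝ) + 1) ^ 3))

include hL hρ' hM in
/-- `M_k → ∞`. [folklore] -/
theorem tendsto_nat_of_div_cube_tendsto : Tendsto M atTop atTop := by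
  have h3 : Tendsto (fun k => L k ^ 3) atTop atTop := tendsto_pow_atTop (by norm_num) |>.comp hL
  have h := hM.pos_mul_atTop hρ' h3
  have h' : Tendsto (fun k => (M k : ℝ)) atTop atTop := by
    refine tendsto_atTop_mono' _ ?_ h
    filter_upwards [hL.eventually (eventually_gt_atTop 0)] with k hk
    have : L k ^ 3 ≠ 0 := by positivity
    rw [div_mul_cancel₀ _ this]
  exact tendsto_natCast_atTop_iff.mp h'

include hL hM in
/-- `(M_k + c)/L_k³ → ρ'`. [folklore] -/
theorem tendsto_add_div_cube (c : ℝ) : Tendsto (fun k => ((M k : ℝ) + c) / L k ^ 3) atTop (𝓝 ρ') := by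
  have h3 : Tendsto (fun k => L k ^ 3) atTop atTop := tendsto_pow_atTop (by norm_num) |>.comp hL
  have h0 : Tendsto (fun k => c / L k ^ 3) atTop (𝓝 0) := tendsto_const_nhds.div_atTop h3
  have := hM.add h0
  simp only [add_zero] at this
  refine this.congr fun k => ?_
  ring

include hβ hL hρ' hM hζ1 hζ in
/-- **Lower half of the key lemma**: for `x < ζ`, eventually `Q_{Λ,M}/Q_{Λ,M+1} > x`
(otherwise `M+1 = ∑_j tr e^{-jβT} Q_{M+1-j}/Q_{M+1} ≤ ∑_j tr e^{-jβT} x^j ≈ L³ g(x)/λ³ < M`).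
[cite: Suto2002, §2.2 (28)–(30)] -/
theorem eventually_lt_activity {x : ℝ} (hx : x < ζ) :
    ∀ᶠ k in atTop, x < canonicalZ β (L k) (M k) / canonicalZ β (L k) (M k + 1) := by
  have hlam := thermalWavelength_pos hβ
  rcases lt_or_ge x 0 with hxneg | hx0
  · filter_upwards [hL.eventually (eventually_gt_atTop 0)] with k hk
    exact hxneg.trans (div_pos (canonicalZ_pos hβ hk.ne' _) (canonicalZ_pos hβ hk.ne' _))
  have hx1 : x < 1 := lt_of_lt_of_le hx hζ1
  -- `g(x)/λ³ < ρ'`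
  have hgx := boseFun_lt_of_lt_saturated hζ1 hζ hx0 hx
  set c := (∑' j : ℕ, x ^ (j + 1) / Real.sqrt ((j : ℝ) + 1) ^ 3) / thermalWavelength β ^ 3
    with hc
  have hcρ : c < ρ' := by
    rw [hc, div_lt_iff₀ (by positivity)]; exact hgx
  have hM1 : Tendsto (fun k => M k + 1) atTop atTop :=
    tendsto_add_atTop_nat 1 |>.comp (tendsto_nat_of_div_cube_tendsto hL hρ' hM)
  have h1 := tendsto_sum_torusHeatTrace_mul_pow hβ hx0 hx1 hL hM1
  rw [← hc] at h1
  have h2 := tendsto_add_div_cube hL hM 1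
  have hmid : c < (c + ρ') / 2 ∧ (c + ρ') / 2 < ρ' := by constructor <;> linarith
  filter_upwards [(tendsto_order.1 h1).2 _ hmid.1, (tendsto_order.1 h2).1 _ hmid.2,
    hL.eventually (eventually_gt_atTop 0)] with k hk1 hk2 hLk
  -- at this `k`: if the ratio were `≤ x` the identity would give `(M+1)/L³ ≤ (∑ …)/L³`
  by_contra hcon
  rw [not_lt] at hcon
  have hpos : ∀ n, 0 < canonicalZ β (L k) n := canonicalZ_pos hβ hLk.ne'
  have hlc := canonicalZ_logConcave hβ hLk
  set r := canonicalZ β (L k) (M k) / canonicalZ β (L k) (M k + 1) with hr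
  have hr0 : 0 ≤ r := (div_pos (hpos _) (hpos _)).le
  have hid := sum_torusHeatTrace_mul_ratio hβ hLk.ne' (M k + 1)
  have hle : ((M k + 1 : ℕ) : ℝ) ≤
      ∑ j ∈ Finset.Icc 1 (M k + 1), torusHeatTrace (L k) (j * β) * x ^ j := by
    rw [← hid]
    refine Finset.sum_le_sum fun j hj => ?_
    obtain ⟨hj1, hjM⟩ := Finset.mem_Icc.mp hj
    have hz : 0 ≤ torusHeatTrace (L k) (j * β) :=
      (one_le_torusHeatTrace hLk.ne' (by positivity)).trans' zero_le_one
    refine mul_le_mul_of_nonneg_left ?_ hz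
    calc canonicalZ β (L k) (M k + 1 - j) / canonicalZ β (L k) (M k + 1) ≤ r ^ j :=
          div_le_ratio_pow' hpos hlc hj1 hjM
      _ ≤ x ^ j := pow_le_pow_left₀ hr0 hcon j
  have hle' : ((M k : ℝ) + 1) / L k ^ 3 ≤
      (∑ j ∈ Finset.Icc 1 (M k + 1), torusHeatTrace (L k) (j * β) * x ^ j) / L k ^ 3 := by
    push_cast at hle
    exact div_le_div_of_nonneg_right hle (by positivity)
  linarith

include hβ hL hM hζ0 hζ in
/-- **Upper half of the key lemma** (only below the critical density, `ζ < 1`): for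
`ζ < x ≤ 1`, eventually `Q_{Λ,M}/Q_{Λ,M+1} < x` (otherwise, truncating the identity at `M+J` to
its first `J` terms, `M + J ≥ ∑_{j≤J} tr e^{-jβT} x^j ≈ L³ g_J(x)/λ³ > M`).
[cite: Suto2002, §2.2 (28)–(29)] -/
theorem eventually_activity_lt (hζ1' : ζ < 1) {x : ℝ} (hx : ζ < x) (hx1 : x ≤ 1) :
    ∀ᶠ k in atTop, canonicalZ β (L k) (M k) / canonicalZ β (L k) (M k + 1) < x := by
  have hlam := thermalWavelength_pos hβ
  set lam := thermalWavelength β with hlam_def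
  have hx0 : 0 ≤ x := hζ0.le.trans hx.le
  -- `g(x) > ρ'λ³`, hence some partial sum already exceeds `ρ'λ³`
  have hgx := lt_boseFun_of_saturated_lt hζ0.le hζ1' hζ hx hx1
  obtain ⟨J, hJ⟩ := ((tendsto_order.1 (tendsto_sum_range_boseTerm hx0 hx1)).1 _ hgx).exists
  set c := (∑ j ∈ Finset.range J, x ^ (j + 1) / Real.sqrt ((j : ℝ) + 1) ^ 3) / lam ^ 3 with hc
  have hcρ : ρ' < c := by rw [hc, lt_div_iff₀ (by positivity)]; exact hJ
  -- the truncated sums converge to `c`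
  have h1 : Tendsto (fun k => ∑ j ∈ Finset.range J,
      torusHeatTrace (L k) ((j + 1 : ℕ) * β) / L k ^ 3 * x ^ (j + 1)) atTop (𝓝 c) := by
    have : c = ∑ j ∈ Finset.range J,
        ((lam * Real.sqrt ((j + 1 : ℕ) : ℝ)) ^ 3)⁻¹ * x ^ (j + 1) := by
      rw [hc, Finset.sum_div]
      refine Finset.sum_congr rfl fun j _ => ?_
      push_cast
      rw [mul_pow]
      field_simp
    rw [this]
    refine tendsto_finsetSum _ fun j _ => ?_
    exact ((tendsto_torusHeatTrace_div_cube hβ (j := j + 1) (by omega)).comp hL).mul_const _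
  have h2 := tendsto_add_div_cube hL hM J
  have hmid : ρ' < (c + ρ') / 2 ∧ (c + ρ') / 2 < c := by constructor <;> linarith
  filter_upwards [(tendsto_order.1 h2).2 _ hmid.1, (tendsto_order.1 h1).1 _ hmid.2,
    hL.eventually (eventually_gt_atTop 0)] with k hk2 hk1 hLk
  by_contra hcon
  rw [not_lt] at hcon
  have hpos : ∀ n, 0 < canonicalZ β (L k) n := canonicalZ_pos hβ hLk.ne'
  have hlc := canonicalZ_logConcave hβ hLk
  set r := canonicalZ β (L k) (M k) / canonicalZ β (L k) (M k + 1) with hr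
  set M' := M k + J with hM'
  have hid := sum_torusHeatTrace_mul_ratio hβ hLk.ne' M'
  -- truncate the identity at `J` and bound each ratio below by `r^j ≥ x^j`
  have hge : ∑ j ∈ Finset.Icc 1 J, torusHeatTrace (L k) (j * β) * x ^ j ≤ (M' : ℝ) := by
    rw [← hid]
    have hsub : Finset.Icc 1 J ⊆ Finset.Icc 1 M' :=
      Finset.Icc_subset_Icc le_rfl (by omega)
    refine (Finset.sum_le_sum fun j hj => ?_).trans
      (Finset.sum_le_sum_of_subset_of_nonneg hsub fun j _ _ => ?_)
    · obtain ⟨hj1, hjJ⟩ := Finset.mem_Icc.mp hj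
      have hz : 0 ≤ torusHeatTrace (L k) (j * β) :=
        (one_le_torusHeatTrace hLk.ne' (by positivity)).trans' zero_le_one
      refine mul_le_mul_of_nonneg_left ?_ hz
      have hjM' : j ≤ M' := by omega
      calc x ^ j ≤ r ^ j := pow_le_pow_left₀ hx0 hcon j
        _ ≤ (canonicalZ β (L k) (M' - j) / canonicalZ β (L k) (M' - j + 1)) ^ j := by
            refine pow_le_pow_left₀ (div_pos (hpos _) (hpos _)).le ?_ j
            exact ratio_monotone_of_logConcave hpos hlc (show M k ≤ M' - j by omega)
        _ ≤ canonicalZ β (L k) (M' - j) / canonicalZ β (L k) M' := ratio_pow_le_div' hpos hlc hjM'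
    · exact mul_nonneg ((one_le_torusHeatTrace hLk.ne' (by
        have := (Finset.mem_Icc.mp ‹_›).1; positivity)).trans' zero_le_one)
        (div_pos (hpos _) (hpos _)).le
  -- rewrite in the `range` form and divide by `L³`
  have hge' : ∑ j ∈ Finset.range J, torusHeatTrace (L k) ((j + 1 : ℕ) * β) / L k ^ 3 * x ^ (j + 1) ≤
      ((M k : ℝ) + J) / L k ^ 3 := by
    have e : ∑ j ∈ Finset.range J, torusHeatTrace (L k) ((j + 1 : ℕ) * β) / L k ^ 3 * x ^ (j + 1) =
        (∑ j ∈ Finset.Icc 1 J, torusHeatTrace (L k) (j * β) * x ^ j) / L k ^ 3 := by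
      rw [sum_Icc_one_eq_sum_range, Finset.sum_div]
      refine Finset.sum_congr rfl fun j _ => ?_
      ring
    rw [e]
    have : (M' : ℝ) = (M k : ℝ) + J := by rw [hM']; push_cast; ring
    rw [← this]
    exact div_le_div_of_nonneg_right hge (by positivity)
  linarith

include hβ hL hρ' hM hζ0 hζ1 hζ in
/-- **Key lemma: the canonical activity `Q_{Λ,M}/Q_{Λ,M+1}` converges to the saturated activity
`ζ`** along any thermodynamic sequence `M/L³ → ρ'` (`g_{3/2}(ζ) = ρ'λ³` if `ρ' < ρ_c`, `ζ = 1`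
if `ρ' ≥ ρ_c`): the canonical counterpart of [Suto2002, §2.2 (28)–(30)], proved here from the
recursion and log-concavity instead of the equivalence of ensembles. [cite: Suto2002, §2.2 (28)–(30)] -/
theorem tendsto_activity :
    Tendsto (fun k => canonicalZ β (L k) (M k) / canonicalZ β (L k) (M k + 1)) atTop (𝓝 ζ) := by
  refine tendsto_order.2 ⟨fun x hx => eventually_lt_activity hβ hL hρ' hM hζ1 hζ hx, fun x hx => ?_⟩
  rcases le_or_gt x 1 with hx1 | hx1
  · have hζ1' : ζ < 1 := lt_of_lt_of_le hx hx1
    exact eventually_activity_lt hβ hL hM hζ0 hζ hζ1' hx hx1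
  · filter_upwards [hL.eventually (eventually_gt_atTop 0)] with k hk
    have hmono := canonicalZ_monotone hβ hk.ne' (Nat.le_succ (M k))
    have hpos := canonicalZ_pos hβ hk.ne' (M k + 1)
    exact lt_of_le_of_lt ((div_le_one hpos).mpr hmono) hx1

end Activity

/-! ### Sütő 2002: the cycle-length distribution in the thermodynamic limit -/

/-- **Sütő's (29)/(30), termwise**: for `j ≥ 1`,
`P_{Λ_{L_N},N}(ξ₁ = j) → ζ^j/(ρ λ_B³ j^{3/2})` with `ζ` the saturated activity at `ρλ_B³`
(`g_{3/2}(ζ) = ρλ_B³` for `ρ < ρ_c`, `ζ = 1` for `ρ ≥ ρ_c`).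
[cite: Suto2002, §2.1 (10), §2.2 (29)–(30)] -/
theorem tendsto_cycleLengthProb {β ρ : ℝ} (hβ : 0 < β) (hρ : 0 < ρ) {ζ : ℝ} (hζ0 : 0 < ζ)
    (hζ1 : ζ ≤ 1)
    (hζ : ∑' j : ℕ, ζ ^ (j + 1) / Real.sqrt ((j : ℝ) + 1) ^ 3 =
      min (ρ * thermalWavelength β ^ 3) (∑' j : ℕ, (1 : ℝ) ^ (j + 1) / Real.sqrt ((j : ℝ) + 1) ^ 3))
    {j : ℕ} (hj : 1 ≤ j) :
    Tendsto (fun N : ℕ => cycleLengthProb β (sideLength ρ N) N j) atTop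
      (𝓝 (ζ ^ j / (ρ * (thermalWavelength β * Real.sqrt j) ^ 3))) := by
  have hlam := thermalWavelength_pos hβ
  set L : ℕ → ℝ := fun N => sideLength ρ N with hLdef
  have hL : Tendsto L atTop atTop := tendsto_sideLength hρ
  have hL3 : Tendsto (fun N => L N ^ 3) atTop atTop := (tendsto_pow_atTop (by norm_num)).comp hL
  set c := (thermalWavelength β * Real.sqrt j) ^ 3 with hc
  have hcpos : 0 < c := by positivity
  -- factor 1: `tr e^{-jβT}/L³ → c⁻¹`
  have F1 : Tendsto (fun N => torusHeatTrace (L N) (j * β) / L N ^ 3) atTop (𝓝 c⁻¹) :=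
    (tendsto_torusHeatTrace_div_cube hβ hj).comp hL
  -- factor 2: `Q_{N-j}/Q_N → ζ^j` (a product of `j` activities, each `→ ζ` by the key lemma)
  have F2 : Tendsto (fun N => canonicalZ β (L N) (N - j) / canonicalZ β (L N) N) atTop
      (𝓝 (ζ ^ j)) := by
    have hprod : ∀ᶠ N in atTop, (∏ i ∈ Finset.range j,
        canonicalZ β (L N) (N - j + i) / canonicalZ β (L N) (N - j + i + 1)) =
          canonicalZ β (L N) (N - j) / canonicalZ β (L N) N := by
      filter_upwards [eventually_ge_atTop j, eventually_ge_atTop 1] with N hN hN1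
      have hpos : ∀ n, 0 < canonicalZ β (L N) n :=
        canonicalZ_pos hβ (sideLength_pos hρ hN1).ne'
      have := div_eq_prod_ratio hpos (N - j) j
      rw [Nat.sub_add_cancel hN] at this
      exact this.symm
    refine Tendsto.congr' hprod ?_
    have hζj : ζ ^ j = ∏ _i ∈ Finset.range j, ζ := by simp
    rw [hζj]
    refine tendsto_finsetProd _ fun i hi => ?_
    have hij : i < j := Finset.mem_range.mp hi
    have hM : Tendsto (fun N => ((N - j + i : ℕ) : ℝ) / L N ^ 3) atTop (𝓝 ρ) := by
      have h0 : Tendsto (fun N => ((j : ℝ) - i) / L N ^ 3) atTop (𝓝 0) :=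
        tendsto_const_nhds.div_atTop hL3
      have h1 : Tendsto (fun N => ρ - ((j : ℝ) - i) / L N ^ 3) atTop (𝓝 ρ) := by
        simpa using (tendsto_const_nhds (x := ρ)).sub h0
      refine h1.congr' ?_
      filter_upwards [eventually_ge_atTop j, eventually_ge_atTop 1] with N hN hN1
      have hNL : (N : ℝ) / L N ^ 3 = ρ :=
        Literature.MathematicalPhysics.QuantumManyBody.BoseGas.div_sideLength_pow_three hρ hN1
      have hL0 : L N ^ 3 ≠ 0 := (pow_pos (sideLength_pos hρ hN1) 3).ne'
      rw [← hNL, Nat.cast_add, Nat.cast_sub hN]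
      field_simp
      ring
    exact tendsto_activity hβ hL hρ hM hζ0 hζ1 hζ
  -- combine: `P_N(j) = (tr e^{-jβT}/L³)/ρ · Q_{N-j}/Q_N` for `N ≥ j`
  have hmul := (F1.div_const ρ).mul F2
  have e : c⁻¹ / ρ * ζ ^ j = ζ ^ j / (ρ * c) := by field_simp
  rw [e] at hmul
  refine hmul.congr' ?_
  filter_upwards [eventually_ge_atTop j, eventually_ge_atTop 1] with N hN hN1
  have hNL : (N : ℝ) / sideLength ρ N ^ 3 = ρ :=
    Literature.MathematicalPhysics.QuantumManyBody.BoseGas.div_sideLength_pow_three hρ hN1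
  have hL0 : sideLength ρ N ≠ 0 := (sideLength_pos hρ hN1).ne'
  have hQ : canonicalZ β (sideLength ρ N) N ≠ 0 :=
    (canonicalZ_pos hβ (sideLength_pos hρ hN1).ne' N).ne'
  have hN' : (N : ℝ) = ρ * sideLength ρ N ^ 3 := (div_eq_iff (pow_ne_zero 3 hL0)).mp hNL
  simp only [hLdef]
  unfold cycleLengthProb
  rw [if_pos ⟨hj, hN⟩, hN']
  field_simp

/-- **Discharge of `Suto2002_cyclePercolation`** (Sütő 2002, perfect gas, `d = 3`): the limits
`P_ρ(ξ₁ = j)` exist and `∑_j P_ρ(ξ₁ = j) = g_{3/2}(ζ)/(ρλ_B³) = min(1, ρ_c/ρ)`.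
[cite: Suto2002, Theorem, §2.2 (29)–(30)] -/
theorem suto2002_cyclePercolation_holds : Suto2002_cyclePercolation := by
  intro β ρ hβ hρ
  have hlam := thermalWavelength_pos hβ
  set lam := thermalWavelength β with hlam_def
  obtain ⟨ζ, hζ0, hζ1, hζ⟩ := exists_saturatedActivity (y := ρ * lam ^ 3) (by positivity)
  refine ⟨fun j => ζ ^ j / (ρ * (lam * Real.sqrt j) ^ 3),
    fun j hj => tendsto_cycleLengthProb hβ hρ hζ0 hζ1 hζ hj, ?_⟩
  have hs := (summable_boseTerm hζ0.le hζ1).hasSum.div_const (ρ * lam ^ 3)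
  rw [hζ] at hs
  have e1 : min (ρ * lam ^ 3) (∑' j : ℕ, (1 : ℝ) ^ (j + 1) / Real.sqrt ((j : ℝ) + 1) ^ 3) /
      (ρ * lam ^ 3) = min 1 (criticalDensity β / ρ) := by
    rw [← min_div_div_right (by positivity), div_self (by positivity), boseFun_one]
    congr 1
    unfold criticalDensity
    rw [← hlam_def]
    field_simp
  rw [e1] at hs
  refine hs.congr_fun fun j => ?_
  push_cast
  rw [mul_pow]
  field_simp

/-! ### Ueltschi 2006, Theorem 4: the zero-mode density in the canonical ensemble -/

/-- **Ueltschi's sum-rule bound** `⟨n₀⟩ ≥ N - ∑_{j≤N} (tr e^{-jβT} - 1)`: from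
`N = ∑_j tr e^{-jβT} Y(N-j)/Y(N)` (the recursion, i.e. the sum rule `N = ∑_k ⟨n_k⟩` with
`⟨n_k⟩ = ∑_{i≥1} e^{-βik²} Y(N-i)/Y(N)`) and `Y(N-i)/Y(N) ≤ 1`.
[cite: Ueltschi2006, App. B (proof of Thm. 4)] -/
theorem sub_sum_le_zeroModeOccupation {β L : ℝ} (hβ : 0 < β) (hL : L ≠ 0) (N : ℕ) :
    (N : ℝ) - ∑ j ∈ Finset.Icc 1 N, (torusHeatTrace L (j * β) - 1) ≤
      zeroModeOccupation β L N := by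
  have hpos : ∀ n, 0 < canonicalZ β L n := canonicalZ_pos hβ hL
  have hmono := canonicalZ_monotone hβ hL
  have hid := sum_torusHeatTrace_mul_ratio hβ hL N
  unfold zeroModeOccupation
  have hu1 : ∀ j ∈ Finset.Icc 1 N, canonicalZ β L (N - j) / canonicalZ β L N ≤ 1 := fun j _ =>
    (div_le_one (hpos N)).mpr (hmono (Nat.sub_le N j))
  have hz : ∀ j ∈ Finset.Icc 1 N, 0 ≤ torusHeatTrace L (j * β) - 1 := fun j hj => by
    have hj1 := (Finset.mem_Icc.mp hj).1
    have ht : (0 : ℝ) < j * β := by positivity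
    linarith [one_le_torusHeatTrace hL ht]
  have hle : ∑ j ∈ Finset.Icc 1 N, (torusHeatTrace L (j * β) - 1) *
      (canonicalZ β L (N - j) / canonicalZ β L N) ≤
        ∑ j ∈ Finset.Icc 1 N, (torusHeatTrace L (j * β) - 1) :=
    Finset.sum_le_sum fun j hj => mul_le_of_le_one_right (hz j hj) (hu1 j hj)
  calc (N : ℝ) - ∑ j ∈ Finset.Icc 1 N, (torusHeatTrace L (j * β) - 1)
      ≤ (N : ℝ) - ∑ j ∈ Finset.Icc 1 N, (torusHeatTrace L (j * β) - 1) *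
          (canonicalZ β L (N - j) / canonicalZ β L N) := by linarith
    _ = ∑ j ∈ Finset.Icc 1 N, canonicalZ β L (N - j) / canonicalZ β L N := by
        rw [← hid, ← Finset.sum_sub_distrib]
        exact Finset.sum_congr rfl fun j _ => by ring

/-- Index bookkeeping for `div_le_ratio_pow`: `Z_{K-i}/Z_{K-i₀} ≤ (Z_{K-i₀-1}/Z_{K-i₀})^{i-i₀}`
for `i₀ ≤ i ≤ K`, `i₀ + 1 ≤ K`. [folklore] -/
theorem div_le_ratio_pow_sub {Z : ℕ → ℝ} (hpos : ∀ n, 0 < Z n)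
    (hlc : ∀ n, Z n * Z (n + 2) ≤ Z (n + 1) ^ 2) {K i₀ i : ℕ} (hK : i₀ + 1 ≤ K) (h1 : i₀ ≤ i)
    (h2 : i ≤ K) :
    Z (K - i) / Z (K - i₀) ≤ (Z (K - i₀ - 1) / Z (K - i₀)) ^ (i - i₀) := by
  rcases Nat.eq_or_lt_of_le h1 with rfl | hlt
  · simp [div_self (hpos _).ne']
  · obtain ⟨s, hs⟩ : ∃ s, i - i₀ = s + 1 := ⟨i - i₀ - 1, by omega⟩
    have h := div_le_ratio_pow hpos hlc (K - i) s
    have e1 : K - i + (s + 1) = K - i₀ := by omega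
    have e2 : K - i + s = K - i₀ - 1 := by omega
    have e3 : K - i₀ - 1 + 1 = K - i₀ := by omega
    rw [e1, e2, e3] at h
    rw [hs]
    exact h

/-- **Tail bound for `⟨n₀⟩`**: for a cut-off `1 ≤ i₀ ≤ N-1` with activity
`r = Q_{Λ,N-i₀-1}/Q_{Λ,N-i₀} < 1`, `⟨n₀⟩_{Λ,N} = ∑_{i=1}^{N} Q_{Λ,N-i}/Q_{Λ,N} ≤ (i₀ - 1) + 1/(1-r)`
(the first `i₀ - 1` terms are `≤ 1`, the others decay geometrically by log-concavity).
[folklore] -/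
theorem zeroModeOccupation_le {β L : ℝ} (hβ : 0 < β) (hL : 0 < L) {N i₀ : ℕ} (hi₀ : 1 ≤ i₀)
    (hiN : i₀ + 1 ≤ N) (hr : canonicalZ β L (N - i₀ - 1) / canonicalZ β L (N - i₀) < 1) :
    zeroModeOccupation β L N ≤
      ((i₀ : ℝ) - 1) + 1 / (1 - canonicalZ β L (N - i₀ - 1) / canonicalZ β L (N - i₀)) := by
  have hpos : ∀ n, 0 < canonicalZ β L n := canonicalZ_pos hβ hL.ne'
  have hlc := canonicalZ_logConcave hβ hL
  have hmono := canonicalZ_monotone hβ hL.ne'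
  set Q := canonicalZ β L with hQ
  set r := Q (N - i₀ - 1) / Q (N - i₀) with hr_def
  have hr0 : 0 ≤ r := (div_pos (hpos _) (hpos _)).le
  unfold zeroModeOccupation
  rw [← hQ]
  have hIcc : Finset.Icc 1 N = Finset.Ico 1 (N + 1) := rfl
  rw [hIcc, ← Finset.sum_Ico_consecutive _ hi₀ (by omega : i₀ ≤ N + 1)]
  refine add_le_add ?_ ?_
  · -- the first `i₀ - 1` terms are at most `1`
    calc ∑ i ∈ Finset.Ico 1 i₀, Q (N - i) / Q N ≤ ∑ _i ∈ Finset.Ico 1 i₀, (1 : ℝ) :=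
          Finset.sum_le_sum fun i _ => (div_le_one (hpos N)).mpr (hmono (Nat.sub_le N i))
      _ = (i₀ : ℝ) - 1 := by
          rw [Finset.sum_const, Nat.card_Ico, nsmul_eq_mul, mul_one, Nat.cast_sub hi₀, Nat.cast_one]
  · -- geometric decay beyond the cut-off
    calc ∑ i ∈ Finset.Ico i₀ (N + 1), Q (N - i) / Q N
        ≤ ∑ i ∈ Finset.Ico i₀ (N + 1), r ^ (i - i₀) := by
          refine Finset.sum_le_sum fun i hi => ?_
          obtain ⟨h1, h2⟩ := Finset.mem_Ico.mp hi
          calc Q (N - i) / Q N ≤ Q (N - i) / Q (N - i₀) :=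
                div_le_div_of_nonneg_left (hpos _).le (hpos _) (hmono (Nat.sub_le N i₀))
            _ ≤ r ^ (i - i₀) := div_le_ratio_pow_sub hpos hlc hiN h1 (by omega)
      _ = ∑ t ∈ Finset.range (N + 1 - i₀), r ^ t := by
          rw [Finset.sum_Ico_eq_sum_range]
          exact Finset.sum_congr rfl fun t _ => by rw [Nat.add_sub_cancel_left]
      _ ≤ ∑' t : ℕ, r ^ t :=
          (summable_geometric_of_lt_one hr0 hr).sum_le_tsum _ fun t _ => pow_nonneg hr0 t
      _ = 1 / (1 - r) := by rw [tsum_geometric_of_lt_one hr0 hr, one_div]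

/-- `N ≤ ρ L_N³` (indeed `=` for `N ≥ 1`). [folklore] -/
theorem natCast_le_mul_sideLength_pow_three {ρ : ℝ} (hρ : 0 < ρ) (N : ℕ) :
    (N : ℝ) ≤ ρ * sideLength ρ N ^ 3 := by
  rw [sideLength_pow_three hρ, mul_div_cancel₀ _ hρ.ne']

/-- **Discharge of `Ueltschi2006_zeroModeOccupation`** (Ueltschi 2006, Thm. 4, `d = 3`):
`⟨n₀⟩_{Λ,N}/L³ → max(0, ρ - ρ_c)` along `L_N = (N/ρ)^{1/3}`.  Lower bound by Ueltschi's sum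
rule and the theta-function estimate of the excited modes; upper bound by the key lemma
(the activity at density `min(ρ,ρ_c) - δ` is `< 1`) and log-concavity, instead of the
free-energy large-deviation estimate in the printed proof [Ueltschi2006, App. B].
[cite: Ueltschi2006, App. B Thm. 4] -/
theorem ueltschi2006_zeroModeOccupation_holds : Ueltschi2006_zeroModeOccupation := by
  intro β ρ hβ hρ
  have hlam := thermalWavelength_pos hβ
  set lam := thermalWavelength β with hlam_def
  set L : ℕ → ℝ := fun N => sideLength ρ N with hLdef
  have hL : Tendsto L atTop atTop := tendsto_sideLength hρ
  have hL3 : Tendsto (fun N => L N ^ 3) atTop atTop := (tendsto_pow_atTop (by norm_num)).comp hL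
  set ρc := criticalDensity β with hρc_def
  -- `g(1) = ρ_c λ³` and `ρ_c > 0`
  have hρc : (∑' j : ℕ, 1 / Real.sqrt ((j : ℝ) + 1) ^ 3) / lam ^ 3 = ρc := by
    rw [hρc_def, criticalDensity, ← hlam_def]
    congr 1
    exact tsum_congr fun j => by rw [sqrt_pow_three (by positivity)]
  have hg1 : ∑' j : ℕ, (1 : ℝ) ^ (j + 1) / Real.sqrt ((j : ℝ) + 1) ^ 3 = ρc * lam ^ 3 := by
    rw [← hρc]
    field_simp
    exact tsum_congr fun j => by rw [one_pow]
  have hg1pos : 0 < ∑' j : ℕ, (1 : ℝ) ^ (j + 1) / Real.sqrt ((j : ℝ) + 1) ^ 3 := by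
    have := boseFun_strictMono le_rfl zero_lt_one le_rfl
    rwa [boseFun_zero] at this
  have hρc_pos : 0 < ρc := by
    have : 0 < ρc * lam ^ 3 := hg1 ▸ hg1pos
    exact pos_of_mul_pos_left this (by positivity)
  -- basic eventual facts along the thermodynamic sequence
  have hev1 : ∀ᶠ N : ℕ in atTop, 1 ≤ N := eventually_ge_atTop 1
  rw [tendsto_order]
  constructor
  · -- lower bound: `∀ a < max 0 (ρ - ρ_c)`, eventually `a < ⟨n₀⟩/L³`
    intro a ha
    rcases lt_or_ge a 0 with ha0 | ha0
    · filter_upwards [hev1] with N hN1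
      have hL0 : 0 < L N := sideLength_pos hρ hN1
      have hocc : 0 ≤ zeroModeOccupation β (L N) N :=
        Finset.sum_nonneg fun i _ =>
          (div_pos (canonicalZ_pos hβ hL0.ne' _) (canonicalZ_pos hβ hL0.ne' _)).le
      exact ha0.trans_le (div_nonneg hocc (by positivity))
    · have ha' : a < ρ - ρc := by
        rcases lt_max_iff.mp ha with h | h
        · exact absurd h (not_lt.mpr ha0)
        · exact h
      set ε := (ρ - ρc - a) / 2 with hε
      have hε0 : 0 < ε := by rw [hε]; linarith
      have hNle : ∀ᶠ N : ℕ in atTop, (N : ℝ) ≤ ρ * L N ^ 3 :=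
        Eventually.of_forall (natCast_le_mul_sideLength_pow_three hρ)
      have hev := eventually_sum_torusHeatTrace_sub_one_le hβ hL hρ hNle hε0
      filter_upwards [hev, hev1] with N hS hN1
      have hL0 : 0 < L N := sideLength_pos hρ hN1
      have hNL : (N : ℝ) / L N ^ 3 = ρ :=
        Literature.MathematicalPhysics.QuantumManyBody.BoseGas.div_sideLength_pow_three hρ hN1
      have hlow := sub_sum_le_zeroModeOccupation hβ hL0.ne' N (β := β)
      have hL30 : 0 < L N ^ 3 := by positivity
      rw [hρc] at hS
      have h1 : ((N : ℝ) - ∑ j ∈ Finset.Icc 1 N, (torusHeatTrace (L N) (j * β) - 1)) / L N ^ 3 ≤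
          zeroModeOccupation β (L N) N / L N ^ 3 := div_le_div_of_nonneg_right hlow hL30.le
      rw [sub_div, hNL] at h1
      show a < zeroModeOccupation β (sideLength ρ N) N / sideLength ρ N ^ 3
      change a < zeroModeOccupation β (L N) N / L N ^ 3
      linarith
  · -- upper bound: `∀ b > max 0 (ρ - ρ_c)`, eventually `⟨n₀⟩/L³ < b`
    intro b hb
    set ρ₀ := max 0 (ρ - ρc) with hρ₀
    have hρ₀0 : 0 ≤ ρ₀ := le_max_left _ _
    have hmin : 0 < min ρ ρc := lt_min hρ hρc_pos
    set δ := min ((b - ρ₀) / 2) (min ρ ρc / 2) with hδ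
    have hδ0 : 0 < δ := lt_min (by linarith) (by linarith)
    have hδb : ρ₀ + δ < b := by
      have : δ ≤ (b - ρ₀) / 2 := min_le_left _ _
      linarith
    have hδm : δ < min ρ ρc := by
      have : δ ≤ min ρ ρc / 2 := min_le_right _ _
      linarith
    set ρ' := min ρ ρc - δ with hρ'
    have hρ'0 : 0 < ρ' := by rw [hρ']; linarith
    have hρ'c : ρ' < ρc := by
      have : min ρ ρc ≤ ρc := min_le_right _ _
      rw [hρ']; linarith
    have hρρ' : ρ - (ρ₀ + δ) = ρ' := by
      rw [hρ', hρ₀]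
      rcases le_total ρ ρc with h | h
      · rw [max_eq_left (by linarith), min_eq_left h]; ring
      · rw [max_eq_right (by linarith), min_eq_right h]; ring
    -- the activity at density `ρ'` is `< 1`
    obtain ⟨ζ', hζ'0, hζ'1, hζ'⟩ := exists_saturatedActivity (y := ρ' * lam ^ 3) (by positivity)
    have hylt : ρ' * lam ^ 3 < ∑' j : ℕ, (1 : ℝ) ^ (j + 1) / Real.sqrt ((j : ℝ) + 1) ^ 3 := by
      rw [hg1]; exact mul_lt_mul_of_pos_right hρ'c (by positivity)
    have hζ'lt : ζ' < 1 := by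
      rcases hζ'1.lt_or_eq with h | h
      · exact h
      · exfalso
        rw [h, min_eq_left hylt.le] at hζ'
        exact hylt.ne' hζ'
    -- the cut-off `i₀(N) = ⌈(ρ₀ + δ) L³⌉`
    set i₀ : ℕ → ℕ := fun N => ⌈(ρ₀ + δ) * L N ^ 3⌉₊ with hi₀
    have hi₀le : ∀ N, (ρ₀ + δ) * L N ^ 3 ≤ i₀ N := fun N => Nat.le_ceil _
    have hi₀lt : ∀ N, 1 ≤ N → (i₀ N : ℝ) < (ρ₀ + δ) * L N ^ 3 + 1 := fun N hN =>
      Nat.ceil_lt_add_one (by have := sideLength_pos hρ hN; positivity)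
    -- eventually `i₀ + 2 ≤ N`
    have hev2 : ∀ᶠ N : ℕ in atTop, i₀ N + 2 ≤ N := by
      filter_upwards [hev1, hL3.eventually (eventually_ge_atTop (3 / ρ'))] with N hN1 hL3N
      have hNL : (N : ℝ) / L N ^ 3 = ρ :=
        Literature.MathematicalPhysics.QuantumManyBody.BoseGas.div_sideLength_pow_three hρ hN1
      have hL30 : 0 < L N ^ 3 := pow_pos (sideLength_pos hρ hN1) 3
      have hN' : (N : ℝ) = ρ * L N ^ 3 := (div_eq_iff hL30.ne').mp hNL
      have h3 : 3 ≤ ρ' * L N ^ 3 := by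
        have := (div_le_iff₀ hρ'0).mp hL3N
        linarith
      have : ((i₀ N + 2 : ℕ) : ℝ) ≤ N := by
        push_cast
        have := hi₀lt N hN1
        rw [hN']
        nlinarith [hρρ']
      exact_mod_cast this
    -- the activity at the cut-off converges to `ζ' < 1`
    have hM : Tendsto (fun N => ((N - i₀ N - 1 : ℕ) : ℝ) / L N ^ 3) atTop (𝓝 ρ') := by
      have h0 : Tendsto (fun N => (1 : ℝ) / L N ^ 3) atTop (𝓝 0) := tendsto_const_nhds.div_atTop hL3
      -- `i₀/L³ → ρ₀ + δ`
      have hi : Tendsto (fun N => (i₀ N : ℝ) / L N ^ 3) atTop (𝓝 (ρ₀ + δ)) := by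
        have hup : Tendsto (fun N => (ρ₀ + δ) + 1 / L N ^ 3) atTop (𝓝 (ρ₀ + δ)) := by
          simpa using (tendsto_const_nhds (x := ρ₀ + δ)).add h0
        refine tendsto_of_tendsto_of_tendsto_of_le_of_le' tendsto_const_nhds hup ?_ ?_
        · filter_upwards [hev1] with N hN1
          have hL30 : 0 < L N ^ 3 := pow_pos (sideLength_pos hρ hN1) 3
          rw [le_div_iff₀ hL30]; exact hi₀le N
        · filter_upwards [hev1] with N hN1
          have hL30 : 0 < L N ^ 3 := pow_pos (sideLength_pos hρ hN1) 3
          rw [div_le_iff₀ hL30]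
          convert (hi₀lt N hN1).le using 1
          rw [add_mul, one_div, inv_mul_cancel₀ hL30.ne']
      have hlim : Tendsto (fun N => ρ - (i₀ N : ℝ) / L N ^ 3 - 1 / L N ^ 3) atTop (𝓝 ρ') := by
        have := ((tendsto_const_nhds (x := ρ)).sub hi).sub h0
        rwa [sub_zero, hρρ'] at this
      refine hlim.congr' ?_
      filter_upwards [hev1, hev2] with N hN1 hN2
      have hNL : (N : ℝ) / L N ^ 3 = ρ :=
        Literature.MathematicalPhysics.QuantumManyBody.BoseGas.div_sideLength_pow_three hρ hN1
      have hL30 : L N ^ 3 ≠ 0 := (pow_pos (sideLength_pos hρ hN1) 3).ne'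
      rw [← hNL, Nat.cast_sub (by omega), Nat.cast_sub (by omega), Nat.cast_one]
      field_simp
    have hK := tendsto_activity hβ hL hρ'0 hM hζ'0 hζ'1 hζ'
    set r₁ := (1 + ζ') / 2 with hr₁
    have hr₁1 : r₁ < 1 := by rw [hr₁]; linarith
    have hζr₁ : ζ' < r₁ := by rw [hr₁]; linarith
    have hC : Tendsto (fun N => (1 / (1 - r₁)) / L N ^ 3) atTop (𝓝 0) :=
      tendsto_const_nhds.div_atTop hL3
    have hgap : 0 < (b - (ρ₀ + δ)) / 2 := by linarith
    filter_upwards [hev1, hev2, (tendsto_order.1 hK).2 _ hζr₁, (tendsto_order.1 hC).2 _ hgap]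
      with N hN1 hN2 hKN hCN
    have hL0 : 0 < L N := sideLength_pos hρ hN1
    have hL30 : 0 < L N ^ 3 := pow_pos hL0 3
    have hi₀1 : 1 ≤ i₀ N := Nat.one_le_iff_ne_zero.mpr (Nat.ceil_pos.mpr (by positivity)).ne'
    -- the activity at the cut-off
    have hMN : N - i₀ N - 1 + 1 = N - i₀ N := by omega
    rw [hMN] at hKN
    have hrN : canonicalZ β (L N) (N - i₀ N - 1) / canonicalZ β (L N) (N - i₀ N) < 1 :=
      hKN.trans hr₁1
    have hocc := zeroModeOccupation_le hβ hL0 hi₀1 (by omega : i₀ N + 1 ≤ N) hrN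
    have h1r : 1 / (1 - canonicalZ β (L N) (N - i₀ N - 1) / canonicalZ β (L N) (N - i₀ N)) ≤
        1 / (1 - r₁) :=
      one_div_le_one_div_of_le (by linarith) (by linarith)
    have hi₀' : (i₀ N : ℝ) - 1 ≤ (ρ₀ + δ) * L N ^ 3 := by linarith [hi₀lt N hN1]
    have htot : zeroModeOccupation β (L N) N ≤ (ρ₀ + δ) * L N ^ 3 + 1 / (1 - r₁) := by linarith
    show zeroModeOccupation β (sideLength ρ N) N / sideLength ρ N ^ 3 < b
    change zeroModeOccupation β (L N) N / L N ^ 3 < b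
    rw [div_lt_iff₀ hL30]
    have := (div_lt_iff₀ hL30).mp hCN
    nlinarith

end Literature.Barriers.AtomisticToContinuum.BoseGas.IdealGas

/-! ### The barrier fact -/

namespace Literature.Barriers.AtomisticToContinuum

open BoseGas.IdealGas

/-- **Discharge of the catalogue entry `FeynmanCyclesVersusCondensation`**: the perfect-gas case
of Sütő's "BEC iff cycle percolation" — the cycle-length distribution `P_ρ(ξ₁ = j)` with
`∑_j P_ρ(ξ₁=j) = min(1, ρ_c/ρ)` [Suto2002, Theorem, (29)–(30)] and the canonical zero-mode
density `max(0, ρ - ρ_c)` [Ueltschi2006, Thm. 4], both along `L_N = (N/ρ)^{1/3}`, `d = 3`.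
The proof is self-contained and elementary: Sütő's cycle-index recursion, log-concavity of
`N ↦ Q_{Λ,N}`, Poisson-summation bounds on `tr e^{-jβT_{Λ,1}}`, and the convergence of the
canonical activity `Q_{Λ,N-1}/Q_{Λ,N}` to the saturated activity (`tendsto_activity`).
[cite: Suto2002, Theorem, §2.2 (29)–(30)] [cite: Ueltschi2006, App. B Thm. 4] -/
theorem FeynmanCyclesVersusCondensation_holds : FeynmanCyclesVersusCondensation :=
  ⟨suto2002_cyclePercolation_holds, ueltschi2006_zeroModeOccupation_holds⟩

end Literature.Barriers.AtomisticToContinuum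

namespace Literature.Barriers.AtomisticToContinuum.BoseGas.IdealGas

/-- **Discharge of `Ueltschi2006_zeroModeOccupation` under its conventional name**
(`<FactName>_holds`, D-0014): Ueltschi 2006, Thm. 4 (`d = 3`), `⟨n₀⟩_{Λ,N}/L³ → max(0, ρ - ρ_c)`
along `L_N = (N/ρ)^{1/3}`; an alias of `ueltschi2006_zeroModeOccupation_holds` above.
[cite: Ueltschi2006, App. B Thm. 4] -/
theorem Ueltschi2006_zeroModeOccupation_holds : Ueltschi2006_zeroModeOccupation :=
  ueltschi2006_zeroModeOccupation_holds

/-- **Discharge of `Suto2002_cyclePercolation` under its conventional name**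
(`<FactName>_holds`, D-0014): Sütő 2002, perfect gas, `d = 3` — along `L_N = (N/ρ)^{1/3}` the
limits `P_ρ(ξ₁ = j)` exist and `∑_j P_ρ(ξ₁ = j) = min(1, ρ_c/ρ)`; an alias of
`suto2002_cyclePercolation_holds` above (same proof term).
[cite: Suto2002, Theorem, §2.2 (29)–(30)] -/
theorem Suto2002_cyclePercolation_holds : Suto2002_cyclePercolation :=
  suto2002_cyclePercolation_holds

end Literature.Barriers.AtomisticToContinuum.BoseGas.IdealGas

end
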